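import Literature.NumberTheory.EllipticCurves.HeckeOperators

/-!
# Double cosets, Shimura's commutativity criterion, and `T_p T_q = T_q T_p` on `S_k(Γ₁(N))`

Companion to `Literature.NumberTheory.EllipticCurves.HeckeOperators` (trunk EllArithM, item C5).
This file **discharges the named fact `Literature.NumberTheory.EllipticCurves.ModularForms.heckeT_comm`** of that file
(`theorem heckeT_comm_holds : heckeT_comm N k`): for all `N ≥ 1`, all weights `k` and *all*
`p, q ≥ 1`, the double coset operators `T_p = [Γ₁(N) diag(1,p) Γ₁(N)]` and `T_q` on `S_k(Γ₁(N))`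
commute; and likewise `heckeT_comm_gamma0` (`heckeT_comm_gamma0_holds`, level `Γ₀(N)`).

## Strategy

Diamond–Shurman prove Prop. 5.2.4(c) (`p, q` prime) from the Fourier coefficient formula (5.4).
Since `heckeT_comm` quantifies over all `p, q ≥ 1` (and `[Γ₁(N) diag(1,n) Γ₁(N)]` is not the
classical `T_n` for composite `n`), we prove instead the underlying statement about the abstract
Hecke ring `R(Γ₁(N), Δ)` (Shimura 1971, Ch. 3): the double cosets `Γ₁(N) diag(1,m) Γ₁(N)`,
`m ≥ 1`, commute pairwise. Shimura obtains this from the structure theorem Thm. 3.34(1)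
(`R(Γ', Δ')` is a polynomial ring); we give the direct proof by **Shimura's criterion Prop. 3.8**
(an anti-involution `*` of `G` with `Γ* = Γ` and `(Γ x Γ)* = Γ x Γ` for all `x ∈ Δ` forces
`R(Γ, Δ)` to be commutative), applied to `x ↦ x* := diag(1,N) xᵀ diag(1,N)⁻¹`, i.e.
`(a b; c d)* = (a, c/N; Nb, d)`, which preserves `Γ₁(N)`, fixes every `diag(1,m)`, and satisfies
`x* ∈ Γ₁(N) x Γ₁(N)` for every integer matrix `x = (a b; c d)` with `N ∣ c`, `gcd(a, N) = 1`
(from the classification of these double cosets by determinant, gcd of entries and `a mod N`, the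
`2 × 2` case of Shimura's Prop. 3.32(1), proved here by explicit row and column reduction).
Everything is then transported to cusp forms by the double coset formula (Shimura (3.4.1),
Prop. 3.38; Diamond–Shurman Def. 5.1.3).

## Main results (namespace `Literature.ModularForms`)

* `IsDoubleCosetDecomp Γ Γ' g α`: `α` enumerates the right cosets in `Γ g Γ' = ⊔ᵢ Γ αᵢ`;
  `IsDoubleCosetDecomp.quotEquiv : Γ' ⧸ (g⁻¹ Γ g ∩ Γ') ≃ ι` (Shimura Prop. 3.1; Diamond–Shurman
  Lemma 5.1.2); `isDoubleCosetDecomp_quotient_out`, `exists_isDoubleCosetDecomp` (existence).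
* `sum_quotientFunc_eq_sum_slash`, `coe_heckeCorrespondence_eq_sum`, …: Mathlib's
  `trace Γ' (translate f g)` equals `∑ᵢ f ∣[k] αᵢ` (**double coset formula**, Shimura (3.4.1));
  `coe_heckeOperator_heckeOperator_eq_sum`: `[Γ h Γ]([Γ g Γ] f) = ∑ᵢ ∑ⱼ f ∣[k] (αᵢ βⱼ)`.
* `DoubleCosetsCommute Γ g h`: `(Γ g Γ)(Γ h Γ) = (Γ h Γ)(Γ g Γ)` in `R(Γ, Δ)`, spelled out via
  (3.1.1) as an equality of multisets of right cosets; `…_comm_of_doubleCosetsCommute`: then the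
  operators `[Γ g Γ]`, `[Γ h Γ]` commute on `M_k(Γ)` and `S_k(Γ)`.
* `IsDoubleCosetDecomp.exists_equiv_of_antiInvolution`, `doubleCosetsCommute_of_antiInvolution`:
  **Shimura's criterion Prop. 3.8** for a pair of double cosets.
* `HeckeTComm.exists_gamma1_mul_mul_gamma1_eq`: `Γ₁(N)`-double cosets of integer matrices
  `(a b; c d)`, `N ∣ c`, `gcd(a, N) = 1`, are determined by `det`, the gcd of the entries and
  `a mod N` (cf. Shimura Prop. 3.32(1)); `HeckeTComm.exists_gamma1_starMatrix_eq`: hence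
  `x* ∈ Γ₁(N) x Γ₁(N)`.
* `gamma1_doubleCosetsCommute_diag`, `gamma0_doubleCosetsCommute_diag`: the double cosets of
  `diag(1,m)` and `diag(1,n)` commute for `Γ₁(N)` and `Γ₀(N)`, all `m, n ≥ 1`.
* `heckeT_comm_holds`, `heckeT_comm_gamma0_holds` (discharges); `modHeckeT_comm_gamma1` (the
  same on `M_k(Γ₁(N))`, which for `p, q` prime is Diamond–Shurman Prop. 5.2.4(c) as printed).

## Relation to other files and to Mathlib

* `HeckeOperatorsProofs.lean` proves the double coset formula for the two named facts
  `heckeCorrespondence_apply_eq_sum_slash`, `heckeOperator_apply_eq_sum_slash` (`…_holds`) with a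
  `GL(2, ℝ)`-specific copy of the bijection of Lemma 5.1.2 (`orbitIndexQuot_bijective`). The
  present `IsDoubleCosetDecomp` API is the same argument for an arbitrary group `G` (needed here:
  the criterion Prop. 3.8 is pure group theory) and is meant to be the surviving copy; rebasing
  `HeckeOperatorsProofs.lean` on `IsDoubleCosetDecomp.quotEquiv` is a librarian follow-up. This
  file does not import `HeckeOperatorsProofs.lean` and shares no declaration name with it.
* Mathlib's `Mathlib/NumberTheory/HeckeRing/Defs.lean` defines the abstract Hecke ring
  `HeckeRing Δ H ℤ` of a Hecke pair as a type of formal sums but, in the pinned version, not yet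
  its multiplication; `DoubleCosetsCommute Γ g h` is the elementwise content of the commutation
  of two basis elements of that ring (Shimura (3.1.1) and the injectivity of `R(Γ, Δ) → End(M)` in
  the proof of Prop. 3.4), which is all that the action on modular forms sees.

## References

* G. Shimura, *Introduction to the arithmetic theory of automorphic functions*, Publ. Math. Soc.
  Japan 11, Iwanami Shoten / Princeton University Press, 1971 (lit store
  `book:shimura1973-introduction-arithmetic-theory-automorphic-functions`): §3.1 (Prop. 3.1,
  (3.1.1), Prop. 3.4, Prop. 3.8), §3.3 ((3.3.2), (3.3.3), Prop. 3.32, Thm. 3.34, (3.3.9)),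
  §3.4 ((3.4.1), Prop. 3.38).
* F. Diamond, J. Shurman, *A first course in modular forms*, GTM 228, Springer, 2005, §5.1–5.2
  (Lemma 5.1.2, Def. 5.1.3, Prop. 5.2.4).
-/

noncomputable section

open scoped MatrixGroups ModularForm

open ConjAct Pointwise UpperHalfPlane

namespace Literature.NumberTheory.EllipticCurves.ModularForms

/-! ### Right coset decompositions of a double coset -/

section GroupTheory

variable {G : Type*} [Group G]

/-- `IsDoubleCosetDecomp Γ Γ' g α` says that the family `α : ι → G` is a system of representatives
of the right cosets of `Γ` contained in the double coset `Γ g Γ'`, i.e. `Γ g Γ' = ⊔ᵢ Γ αᵢ`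
(disjoint union): every `αᵢ` lies in `Γ g Γ'`, and every `x ∈ Γ g Γ'` lies in exactly one right
coset `Γ αᵢ` (Shimura 1971, §3.1; Diamond–Shurman §5.1). [folklore] -/
structure IsDoubleCosetDecomp (Γ Γ' : Subgroup G) (g : G) {ι : Type*} (α : ι → G) : Prop where
  /-- Each representative lies in the double coset. -/
  mem : ∀ i, α i ∈ DoubleCoset.doubleCoset g (Γ : Set G) Γ'
  /-- Each element of the double coset lies in exactly one right coset `Γ αᵢ`. -/
  existsUnique : ∀ x ∈ DoubleCoset.doubleCoset g (Γ : Set G) Γ', ∃! i, x * (α i)⁻¹ ∈ Γ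

namespace IsDoubleCosetDecomp

variable {Γ Γ' : Subgroup G} {g : G} {ι : Type*} {α : ι → G}

/-- `g r⁻¹ ∈ Γ g Γ'` for `r ∈ Γ'`. [folklore] -/
lemma mul_inv_mem_doubleCoset (g : G) (Γ Γ' : Subgroup G) (r : Γ') :
    g * (r : G)⁻¹ ∈ DoubleCoset.doubleCoset g (Γ : Set G) Γ' :=
  DoubleCoset.mem_doubleCoset.mpr ⟨1, Γ.one_mem, (r : G)⁻¹, inv_mem r.2, by rw [one_mul]⟩

/-- Distinct representatives lie in distinct right cosets. [folklore] -/
lemma eq_of_mul_inv_mem (h : IsDoubleCosetDecomp Γ Γ' g α) {x : G}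
    (hx : x ∈ DoubleCoset.doubleCoset g (Γ : Set G) Γ') {i j : ι}
    (hi : x * (α i)⁻¹ ∈ Γ) (hj : x * (α j)⁻¹ ∈ Γ) : i = j :=
  (h.existsUnique x hx).unique hi hj

/-- The index of the right coset `Γ αᵢ` containing `g r⁻¹`, for `r ∈ Γ'`. [folklore] -/
def indexOf (h : IsDoubleCosetDecomp Γ Γ' g α) (r : Γ') : ι :=
  (h.existsUnique _ (mul_inv_mem_doubleCoset g Γ Γ' r)).exists.choose

/-- Defining property of `indexOf`: `g r⁻¹ ∈ Γ α_{indexOf r}`. [folklore] -/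
lemma indexOf_spec (h : IsDoubleCosetDecomp Γ Γ' g α) (r : Γ') :
    g * (r : G)⁻¹ * (α (h.indexOf r))⁻¹ ∈ Γ :=
  (h.existsUnique _ (mul_inv_mem_doubleCoset g Γ Γ' r)).exists.choose_spec

/-- `indexOf r = i` iff `g r⁻¹ ∈ Γ αᵢ`. [folklore] -/
lemma indexOf_eq_iff (h : IsDoubleCosetDecomp Γ Γ' g α) (r : Γ') (i : ι) :
    h.indexOf r = i ↔ g * (r : G)⁻¹ * (α i)⁻¹ ∈ Γ :=
  ⟨fun hi ↦ hi ▸ h.indexOf_spec r,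
    fun hi ↦ h.eq_of_mul_inv_mem (mul_inv_mem_doubleCoset g Γ Γ' r) (h.indexOf_spec r) hi⟩

/-- Membership in the conjugate `g⁻¹ Γ g` (Mathlib: `toConjAct g⁻¹ • Γ`). [folklore] -/
lemma mem_conj_iff (Γ : Subgroup G) (g x : G) :
    x ∈ toConjAct g⁻¹ • Γ ↔ g * x * g⁻¹ ∈ Γ := by
  rw [Subgroup.mem_pointwise_smul_iff_inv_smul_mem, ← map_inv, inv_inv, ConjAct.smul_def,
    ofConjAct_toConjAct]

/-- `indexOf` is constant on left cosets of `g⁻¹ Γ g ∩ Γ'` in `Γ'`. [folklore] -/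
lemma indexOf_eq_indexOf (h : IsDoubleCosetDecomp Γ Γ' g α) {r r' : Γ'}
    (hrr' : ((r⁻¹ * r' : Γ') : G) ∈ toConjAct g⁻¹ • Γ) : h.indexOf r = h.indexOf r' := by
  rw [indexOf_eq_iff]
  rw [mem_conj_iff] at hrr'
  have := Γ.mul_mem hrr' (h.indexOf_spec r')
  convert this using 1
  simp only [Subgroup.coe_mul, Subgroup.coe_inv]
  group

/-- The map `Γ' ⧸ (g⁻¹ Γ g ∩ Γ') → ι` sending the class of `r` to the index of the right coset
`Γ αᵢ ∋ g r⁻¹` (Shimura 1971, proof of Prop. 3.1). [folklore] -/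
def quotToIndex (h : IsDoubleCosetDecomp Γ Γ' g α) :
    Γ' ⧸ (toConjAct g⁻¹ • Γ).subgroupOf Γ' → ι :=
  Quotient.lift h.indexOf fun r r' hrr' ↦ h.indexOf_eq_indexOf (by
    rw [← Quotient.eq_iff_equiv, Quotient.eq, QuotientGroup.leftRel_apply,
      Subgroup.mem_subgroupOf] at hrr'
    exact hrr')

/-- Unfolding lemma for `quotToIndex`. [folklore] -/
@[simp] lemma quotToIndex_mk (h : IsDoubleCosetDecomp Γ Γ' g α) (r : Γ') :
    h.quotToIndex ⟦r⟧ = h.indexOf r :=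
  rfl

/-- `quotToIndex` is a bijection `Γ' ⧸ (g⁻¹ Γ g ∩ Γ') → ι` (Shimura 1971, Prop. 3.1;
Diamond–Shurman Lemma 5.1.2). [folklore] -/
lemma quotToIndex_bijective (h : IsDoubleCosetDecomp Γ Γ' g α) :
    Function.Bijective h.quotToIndex := by
  constructor
  · refine Quotient.ind₂ fun r r' (hrr' : h.indexOf r = h.indexOf r') ↦ ?_
    refine Quotient.eq.mpr ?_
    rw [QuotientGroup.leftRel_apply, Subgroup.mem_subgroupOf, mem_conj_iff]
    have h1 := h.indexOf_spec r
    have h2 := h.indexOf_spec r'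
    rw [← hrr'] at h2
    have := Γ.mul_mem h1 (Γ.inv_mem h2)
    convert this using 1
    simp only [Subgroup.coe_mul, Subgroup.coe_inv, mul_inv_rev, inv_inv]
    group
  · intro i
    obtain ⟨x, hx, y, hy, hxy⟩ := DoubleCoset.mem_doubleCoset.mp (h.mem i)
    refine ⟨⟦⟨y, hy⟩⁻¹⟧, ?_⟩
    rw [quotToIndex_mk, indexOf_eq_iff, hxy]
    simp only [Subgroup.coe_inv, inv_inv, mul_inv_rev]
    convert Γ.inv_mem hx using 1
    group

/-- The bijection `Γ' ⧸ (g⁻¹ Γ g ∩ Γ') ≃ ι` attached to a decomposition `Γ g Γ' = ⊔ᵢ Γ αᵢ`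
(Shimura 1971, Prop. 3.1; Diamond–Shurman Lemma 5.1.2). [folklore] -/
def quotEquiv (h : IsDoubleCosetDecomp Γ Γ' g α) :
    Γ' ⧸ (toConjAct g⁻¹ • Γ).subgroupOf Γ' ≃ ι :=
  Equiv.ofBijective _ h.quotToIndex_bijective

/-- Unfolding lemma for `quotEquiv`. [folklore] -/
lemma quotEquiv_apply_mk (h : IsDoubleCosetDecomp Γ Γ' g α) (r : Γ') :
    h.quotEquiv ⟦r⟧ = h.indexOf r :=
  rfl

/-- A decomposition of `Γ g Γ'` indexed by `ι` transported along `e : ι' ≃ ι`. [folklore] -/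
lemma comp_equiv (h : IsDoubleCosetDecomp Γ Γ' g α) {ι' : Type*} (e : ι' ≃ ι) :
    IsDoubleCosetDecomp Γ Γ' g (α ∘ e) where
  mem i := h.mem (e i)
  existsUnique x hx := by
    obtain ⟨i, hi, hi'⟩ := h.existsUnique x hx
    refine ⟨e.symm i, by simpa using hi, fun j hj ↦ ?_⟩
    rw [Equiv.eq_symm_apply]
    exact hi' _ hj

end IsDoubleCosetDecomp

/-! ### Existence of decompositions -/

/-- For `x = γ g δ ∈ Γ g Γ'` and `r ∈ Γ'`: `x (g r⁻¹)⁻¹ ∈ Γ` iff `r` and `δ⁻¹` have the same class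
in `Γ' ⧸ (g⁻¹ Γ g ∩ Γ')` (Shimura 1971, proof of Prop. 3.1). [folklore] -/
theorem IsDoubleCosetDecomp.mul_inv_mem_iff_mk_eq (Γ Γ' : Subgroup G) (g : G) {γ δ : G}
    (hγ : γ ∈ Γ) (hδ : δ ∈ Γ') (r : Γ') :
    γ * g * δ * (g * (r : G)⁻¹)⁻¹ ∈ Γ ↔
      (⟦r⟧ : Γ' ⧸ (toConjAct g⁻¹ • Γ).subgroupOf Γ') = ⟦(⟨δ, hδ⟩ : Γ')⁻¹⟧ := by
  rw [Quotient.eq'', QuotientGroup.leftRel_apply, Subgroup.mem_subgroupOf,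
    IsDoubleCosetDecomp.mem_conj_iff, mul_inv_rev, inv_inv, mul_assoc, mul_assoc,
    Subgroup.mul_mem_cancel_left Γ hγ, ← inv_mem_iff (x := g * _ * g⁻¹)]
  simp only [Subgroup.coe_mul, InvMemClass.coe_inv, mul_inv_rev, inv_inv]
  simp only [mul_assoc]

/-- **Existence of a right coset decomposition indexed by the quotient**: for any subgroups
`Γ, Γ'` and `g ∈ G`, the elements `g r⁻¹`, `r` running over representatives of
`Γ' ⧸ (g⁻¹ Γ g ∩ Γ')`, form a system of representatives of `Γ \ Γ g Γ'`
(Shimura 1971, Prop. 3.1; Diamond–Shurman Lemma 5.1.2). [folklore] -/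
theorem isDoubleCosetDecomp_quotient_out (Γ Γ' : Subgroup G) (g : G) :
    IsDoubleCosetDecomp Γ Γ' g
      (fun q : Γ' ⧸ (toConjAct g⁻¹ • Γ).subgroupOf Γ' ↦ g * ((q.out : Γ') : G)⁻¹) where
  mem q := IsDoubleCosetDecomp.mul_inv_mem_doubleCoset g Γ Γ' q.out
  existsUnique x hx := by
    obtain ⟨γ, hγ, δ, hδ, rfl⟩ := DoubleCoset.mem_doubleCoset.mp hx
    refine ⟨⟦(⟨δ, hδ⟩ : Γ')⁻¹⟧, ?_, fun q hq ↦ ?_⟩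
    · dsimp only
      rw [IsDoubleCosetDecomp.mul_inv_mem_iff_mk_eq Γ Γ' g hγ hδ, Quotient.out_eq]
    · dsimp only at hq
      rw [IsDoubleCosetDecomp.mul_inv_mem_iff_mk_eq Γ Γ' g hγ hδ, Quotient.out_eq] at hq
      exact hq

/-- **Existence of a finite right coset decomposition** `Γ g Γ' = ⊔_{i < n} Γ αᵢ` when
`Γ' ⧸ (g⁻¹ Γ g ∩ Γ')` is finite (Shimura 1971, Prop. 3.1; Diamond–Shurman Lemma 5.1.2).
[folklore] -/
theorem exists_isDoubleCosetDecomp (Γ Γ' : Subgroup G) (g : G)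
    [Finite (Γ' ⧸ (toConjAct g⁻¹ • Γ).subgroupOf Γ')] :
    ∃ (n : ℕ) (α : Fin n → G), IsDoubleCosetDecomp Γ Γ' g α := by
  letI := Fintype.ofFinite (Γ' ⧸ (toConjAct g⁻¹ • Γ).subgroupOf Γ')
  exact ⟨_, _, (isDoubleCosetDecomp_quotient_out Γ Γ' g).comp_equiv (Fintype.equivFin _).symm⟩

end GroupTheory

/-! ### The double coset formula for `trace ∘ translate` -/

section Formula

variable {Γ Γ' : Subgroup (GL (Fin 2) ℝ)} {k : ℤ} {g : GL (Fin 2) ℝ} {ι : Type*} [Fintype ι]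
  {α : ι → GL (Fin 2) ℝ}

/-- **Double coset formula** at the level of functions: if `Γ g Γ' = ⊔ᵢ Γ αᵢ` and `f` is
`Γ`-invariant of weight `k`, then `∑_{r ∈ Γ'/(g⁻¹Γg ∩ Γ')} (f ∣[k] g) ∣[k] r⁻¹ = ∑ᵢ f ∣[k] αᵢ`;
the left-hand side is Mathlib's `SlashInvariantForm.trace Γ' (translate f g)`
(Shimura 1971, Prop. 3.1 and (3.4.1); Diamond–Shurman Lemma 5.1.2, Def. 5.1.3). [folklore] -/
theorem sum_quotientFunc_eq_sum_slash (h : IsDoubleCosetDecomp Γ Γ' g α)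
    {F : Type*} [FunLike F ℍ ℂ] [SlashInvariantFormClass F Γ k] (f : F)
    {F' : Type*} [FunLike F' ℍ ℂ] [SlashInvariantFormClass F' (toConjAct g⁻¹ • Γ) k] (f' : F')
    (hf' : (⇑f' : ℍ → ℂ) = ⇑f ∣[k] g)
    [Fintype (Γ' ⧸ (toConjAct g⁻¹ • Γ).subgroupOf Γ')] :
    ∑ q : Γ' ⧸ (toConjAct g⁻¹ • Γ).subgroupOf Γ', SlashInvariantForm.quotientFunc f' q =
      ∑ i, (⇑f : ℍ → ℂ) ∣[k] α i := by
  rw [← h.quotEquiv.sum_comp]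
  refine Fintype.sum_congr _ _ (Quotient.ind fun r ↦ ?_)
  rw [SlashInvariantForm.quotientFunc_mk, hf', ← SlashAction.slash_mul, h.quotEquiv_apply_mk]
  have hγ := h.indexOf_spec r
  set γ := g * (r : GL (Fin 2) ℝ)⁻¹ * (α (h.indexOf r))⁻¹ with hγ_def
  have : g * (r : GL (Fin 2) ℝ)⁻¹ = γ * α (h.indexOf r) := by rw [hγ_def, inv_mul_cancel_right]
  rw [this, SlashAction.slash_mul, SlashInvariantFormClass.slash_action_eq f γ hγ]

end Formula

/-! ### The double coset formula for the Hecke correspondence -/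

section DoubleCosetFormula

variable (Γ Γ' : Subgroup (GL (Fin 2) ℝ)) [Γ.IsArithmetic] [Γ'.IsArithmetic] (k : ℤ)

/-- **Double coset formula** for `heckeCorrespondence`: if `Γ g Γ' = ⊔ᵢ Γ αᵢ` then
`[Γ g Γ'] f = ∑ᵢ f ∣[k] αᵢ` (Shimura 1971, Prop. 3.1 and (3.4.1); Diamond–Shurman Def. 5.1.3
with Lemma 5.1.2). The named facts `heckeCorrespondence_apply_eq_sum_slash`,
`heckeOperator_apply_eq_sum_slash` of `HeckeOperators.lean` (unbundled hypotheses) are the same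
statement; their discharges `…_holds` live in `HeckeOperatorsProofs.lean`.
[cite: Shimura1971, Prop. 3.1 and (3.4.1)] -/
theorem coe_heckeCorrespondence_eq_sum (g : GL (Fin 2) ℚ) {ι : Type*} [Fintype ι]
    {α : ι → GL (Fin 2) ℝ} (h : IsDoubleCosetDecomp Γ Γ' (glCast g) α) (f : ModularForm Γ k) :
    (⇑(heckeCorrespondence Γ Γ' k g f) : ℍ → ℂ) = ∑ i, ⇑f ∣[k] α i := by
  change ⇑(ModularForm.trace Γ' (ModularForm.translate f (glCast g))) = _
  rw [ModularForm.coe_trace]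
  letI := Fintype.ofFinite (Γ' ⧸ (toConjAct (glCast g)⁻¹ • Γ).subgroupOf Γ')
  exact sum_quotientFunc_eq_sum_slash h f _ (ModularForm.coe_translate f _)

/-- Double coset formula for `cuspHeckeCorrespondence`: `[Γ g Γ'] f = ∑ᵢ f ∣[k] αᵢ` on cusp
forms. [cite: Shimura1971, Prop. 3.1 and (3.4.1)] -/
theorem coe_cuspHeckeCorrespondence_eq_sum (g : GL (Fin 2) ℚ) {ι : Type*} [Fintype ι]
    {α : ι → GL (Fin 2) ℝ} (h : IsDoubleCosetDecomp Γ Γ' (glCast g) α) (f : CuspForm Γ k) :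
    (⇑(cuspHeckeCorrespondence Γ Γ' k g f) : ℍ → ℂ) = ∑ i, ⇑f ∣[k] α i := by
  rw [coe_cuspHeckeCorrespondence]
  exact coe_heckeCorrespondence_eq_sum Γ Γ' k g h f

/-- **Composition of Hecke operators**: if `Γ g Γ = ⊔ᵢ Γ αᵢ` and `Γ h Γ = ⊔ⱼ Γ βⱼ` then
`[Γ h Γ] ([Γ g Γ] f) = ∑ᵢ ∑ⱼ f ∣[k] (αᵢ βⱼ)` (Shimura 1971, Prop. 3.38: `[XY]_k = [X]_k [Y]_k`, the
action of `R(Γ, Δ)` on forms is multiplicative). [cite: Shimura1971, Prop. 3.38] -/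
theorem coe_heckeOperator_heckeOperator_eq_sum (g h : GL (Fin 2) ℚ) {ι κ : Type*} [Fintype ι]
    [Fintype κ] {α : ι → GL (Fin 2) ℝ} {β : κ → GL (Fin 2) ℝ}
    (hα : IsDoubleCosetDecomp Γ Γ (glCast g) α) (hβ : IsDoubleCosetDecomp Γ Γ (glCast h) β)
    (f : ModularForm Γ k) :
    (⇑(heckeOperator Γ k h (heckeOperator Γ k g f)) : ℍ → ℂ) = ∑ i, ∑ j, ⇑f ∣[k] (α i * β j) := by
  rw [heckeOperator, coe_heckeCorrespondence_eq_sum Γ Γ k h hβ, heckeOperator,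
    coe_heckeCorrespondence_eq_sum Γ Γ k g hα, Finset.sum_comm]
  simp only [SlashAction.sum_slash, SlashAction.slash_mul]

/-- Composition of Hecke operators on cusp forms: `[Γ h Γ] ([Γ g Γ] f) = ∑ᵢ ∑ⱼ f ∣[k] (αᵢ βⱼ)`
(Shimura 1971, Prop. 3.38). [cite: Shimura1971, Prop. 3.38] -/
theorem coe_cuspHeckeOperator_cuspHeckeOperator_eq_sum (g h : GL (Fin 2) ℚ) {ι κ : Type*}
    [Fintype ι] [Fintype κ] {α : ι → GL (Fin 2) ℝ} {β : κ → GL (Fin 2) ℝ}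
    (hα : IsDoubleCosetDecomp Γ Γ (glCast g) α) (hβ : IsDoubleCosetDecomp Γ Γ (glCast h) β)
    (f : CuspForm Γ k) :
    (⇑(cuspHeckeOperator Γ k h (cuspHeckeOperator Γ k g f)) : ℍ → ℂ) =
      ∑ i, ∑ j, ⇑f ∣[k] (α i * β j) := by
  rw [cuspHeckeOperator, coe_cuspHeckeCorrespondence_eq_sum Γ Γ k h hβ, cuspHeckeOperator,
    coe_cuspHeckeCorrespondence_eq_sum Γ Γ k g hα, Finset.sum_comm]
  simp only [SlashAction.sum_slash, SlashAction.slash_mul]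

end DoubleCosetFormula

/-! ### Commuting double cosets -/

section Commute

/-- `DoubleCosetsCommute Γ g h`: the double cosets `Γ g Γ` and `Γ h Γ` **commute in the Hecke
ring** `R(Γ, Δ)` (Shimura 1971, §3.1), spelled out concretely: there are decompositions
`Γ g Γ = ⊔ᵢ Γ αᵢ`, `Γ h Γ = ⊔ⱼ Γ βⱼ` (finite) and a bijection `e : ι × κ ≃ κ × ι` such that
`Γ αᵢ βⱼ = Γ β_{j'} α_{i'}` whenever `e (i, j) = (j', i')`; i.e. the multisets of right cosets
`{Γ αᵢ βⱼ}` and `{Γ βⱼ αᵢ}` coincide, which by the definition of the product in `R(Γ, Δ)`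
(Shimura (3.1.1): the multiplicity of `Γ ξ Γ` in `(ΓgΓ)(ΓhΓ)` is `#{(i, j) : Γ αᵢ βⱼ = Γ ξ}`)
and the injectivity of `R(Γ, Δ) → Hom(M, M)`, `M` the free module on right cosets (proof of
Shimura's Prop. 3.4), is the identity `(Γ g Γ)(Γ h Γ) = (Γ h Γ)(Γ g Γ)`.
[cite: Shimura1971, §3.1 (3.1.1)] -/
def DoubleCosetsCommute {G : Type*} [Group G] (Γ : Subgroup G) (g h : G) : Prop :=
  ∃ (ι κ : Type) (_ : Fintype ι) (_ : Fintype κ) (α : ι → G) (β : κ → G),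
    IsDoubleCosetDecomp Γ Γ g α ∧ IsDoubleCosetDecomp Γ Γ h β ∧
      ∃ e : ι × κ ≃ κ × ι, ∀ i j, α i * β j * (β (e (i, j)).1 * α (e (i, j)).2)⁻¹ ∈ Γ

/-- `DoubleCosetsCommute` is symmetric in `g, h`. [folklore] -/
lemma DoubleCosetsCommute.symm {G : Type*} [Group G] {Γ : Subgroup G} {g h : G}
    (H : DoubleCosetsCommute Γ g h) : DoubleCosetsCommute Γ h g := by
  obtain ⟨ι, κ, _, _, α, β, hα, hβ, e, he⟩ := H
  refine ⟨κ, ι, inferInstance, inferInstance, β, α, hβ, hα, e.symm, fun j i ↦ ?_⟩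
  have := Γ.inv_mem (he (e.symm (j, i)).1 (e.symm (j, i)).2)
  simpa using this

variable (Γ : Subgroup (GL (Fin 2) ℝ)) [Γ.IsArithmetic] (k : ℤ)

/-- If `Γ g Γ` and `Γ h Γ` commute in the Hecke ring, the Hecke operators `[Γ g Γ]`, `[Γ h Γ]`
on `M_k(Γ)` commute (Shimura 1971, Prop. 3.38 and the remark following it: `f ↦ f ∣ [Γ α Γ]_k`
is a representation of `R(Γ, Δ)`). [cite: Shimura1971, Prop. 3.38] -/
theorem heckeOperator_comm_of_doubleCosetsCommute (g h : GL (Fin 2) ℚ)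
    (H : DoubleCosetsCommute Γ (glCast g) (glCast h)) (f : ModularForm Γ k) :
    heckeOperator Γ k h (heckeOperator Γ k g f) = heckeOperator Γ k g (heckeOperator Γ k h f) := by
  obtain ⟨ι, κ, _, _, α, β, hα, hβ, e, he⟩ := H
  apply DFunLike.ext'
  rw [coe_heckeOperator_heckeOperator_eq_sum Γ k g h hα hβ,
    coe_heckeOperator_heckeOperator_eq_sum Γ k h g hβ hα, ← Fintype.sum_prod_type',
    ← Fintype.sum_prod_type', ← e.sum_comp]
  refine Fintype.sum_congr _ _ fun ij ↦ ?_
  obtain ⟨i, j⟩ := ij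
  have : α i * β j =
      α i * β j * (β (e (i, j)).1 * α (e (i, j)).2)⁻¹ * (β (e (i, j)).1 * α (e (i, j)).2) := by
    rw [inv_mul_cancel_right]
  rw [this, SlashAction.slash_mul, SlashInvariantFormClass.slash_action_eq f _ (he i j)]

/-- If `Γ g Γ` and `Γ h Γ` commute in the Hecke ring, the Hecke operators `[Γ g Γ]`, `[Γ h Γ]`
on `S_k(Γ)` commute (Shimura 1971, Prop. 3.38). [cite: Shimura1971, Prop. 3.38] -/
theorem cuspHeckeOperator_comm_of_doubleCosetsCommute (g h : GL (Fin 2) ℚ)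
    (H : DoubleCosetsCommute Γ (glCast g) (glCast h)) (f : CuspForm Γ k) :
    cuspHeckeOperator Γ k h (cuspHeckeOperator Γ k g f) =
      cuspHeckeOperator Γ k g (cuspHeckeOperator Γ k h f) := by
  obtain ⟨ι, κ, _, _, α, β, hα, hβ, e, he⟩ := H
  apply DFunLike.ext'
  rw [coe_cuspHeckeOperator_cuspHeckeOperator_eq_sum Γ k g h hα hβ,
    coe_cuspHeckeOperator_cuspHeckeOperator_eq_sum Γ k h g hβ hα, ← Fintype.sum_prod_type',
    ← Fintype.sum_prod_type', ← e.sum_comp]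
  refine Fintype.sum_congr _ _ fun ij ↦ ?_
  obtain ⟨i, j⟩ := ij
  have : α i * β j =
      α i * β j * (β (e (i, j)).1 * α (e (i, j)).2)⁻¹ * (β (e (i, j)).1 * α (e (i, j)).2) := by
    rw [inv_mul_cancel_right]
  rw [this, SlashAction.slash_mul, SlashInvariantFormClass.slash_action_eq f _ (he i j)]

variable [Γ.HasDetOne]

/-- Commuting double cosets give commuting `ℂ`-linear Hecke operators on `S_k(Γ)` (as elements of
`End_ℂ S_k(Γ)`) (Shimura 1971, Prop. 3.38). [cite: Shimura1971, Prop. 3.38] -/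
theorem cuspHeckeOperatorₗ_comm_of_doubleCosetsCommute (g h : GL(2, ℚ)⁺)
    (H : DoubleCosetsCommute Γ (glCast (g : GL (Fin 2) ℚ)) (glCast (h : GL (Fin 2) ℚ))) :
    cuspHeckeOperatorₗ Γ k h * cuspHeckeOperatorₗ Γ k g =
      cuspHeckeOperatorₗ Γ k g * cuspHeckeOperatorₗ Γ k h := by
  ext1 f
  exact cuspHeckeOperator_comm_of_doubleCosetsCommute Γ k g h H f

/-- Commuting double cosets give commuting `ℂ`-linear Hecke operators on `M_k(Γ)` (as elements of
`End_ℂ M_k(Γ)`) (Shimura 1971, Prop. 3.38). [cite: Shimura1971, Prop. 3.38] -/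
theorem heckeOperatorₗ_comm_of_doubleCosetsCommute (g h : GL(2, ℚ)⁺)
    (H : DoubleCosetsCommute Γ (glCast (g : GL (Fin 2) ℚ)) (glCast (h : GL (Fin 2) ℚ))) :
    heckeOperatorₗ Γ k h * heckeOperatorₗ Γ k g = heckeOperatorₗ Γ k g * heckeOperatorₗ Γ k h := by
  ext1 f
  exact heckeOperator_comm_of_doubleCosetsCommute Γ k g h H f

end Commute

/-! ### Shimura's commutativity criterion (Prop. 3.8) -/

section Criterion

variable {G : Type*} [Group G]

namespace IsDoubleCosetDecomp

/-! #### Elementary lemmas on double cosets `Γ g Γ` -/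

/-- `Γ g Γ · Γ ⊆ Γ g Γ`. [folklore] -/
theorem mul_mem_doubleCoset {Γ : Subgroup G} {g a c : G}
    (ha : a ∈ DoubleCoset.doubleCoset g (Γ : Set G) Γ) (hc : c ∈ Γ) :
    a * c ∈ DoubleCoset.doubleCoset g (Γ : Set G) Γ := by
  obtain ⟨u, hu, v, hv, rfl⟩ := DoubleCoset.mem_doubleCoset.mp ha
  exact DoubleCoset.mem_doubleCoset.mpr ⟨u, hu, v * c, Γ.mul_mem hv hc, by simp only [mul_assoc]⟩

/-- `Γ · Γ g Γ ⊆ Γ g Γ`. [folklore] -/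
theorem mem_doubleCoset_mul {Γ : Subgroup G} {g a c : G} (hc : c ∈ Γ)
    (ha : a ∈ DoubleCoset.doubleCoset g (Γ : Set G) Γ) :
    c * a ∈ DoubleCoset.doubleCoset g (Γ : Set G) Γ := by
  obtain ⟨u, hu, v, hv, rfl⟩ := DoubleCoset.mem_doubleCoset.mp ha
  exact DoubleCoset.mem_doubleCoset.mpr ⟨c * u, Γ.mul_mem hc hu, v, hv, by simp only [mul_assoc]⟩

/-- If `Δ ⊇ Γ` is closed under multiplication and `g ∈ Δ` then `Γ g Γ ⊆ Δ`. [folklore] -/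
theorem doubleCoset_subset_of_mul_mem {Γ : Subgroup G} {Δ : Set G} (hΓΔ : (Γ : Set G) ⊆ Δ)
    (hΔ : ∀ x ∈ Δ, ∀ y ∈ Δ, x * y ∈ Δ) {g : G} (hg : g ∈ Δ) :
    DoubleCoset.doubleCoset g (Γ : Set G) Γ ⊆ Δ := by
  intro y hy
  obtain ⟨u, hu, v, hv, rfl⟩ := DoubleCoset.mem_doubleCoset.mp hy
  exact hΔ _ (hΔ _ (hΓΔ hu) _ hg) _ (hΓΔ hv)

/-! #### Anti-involutions -/

/-- An anti-automorphism fixes `1`. [folklore] -/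
theorem antiInvolution_one (star : G → G) (hmul : ∀ x y, star (x * y) = star y * star x)
    (hinv : Function.Involutive star) : star 1 = 1 := by
  have h := hmul 1 (star 1)
  rw [one_mul, hinv] at h
  exact mul_eq_left.mp h.symm

/-- An anti-automorphism commutes with inversion. [folklore] -/
theorem antiInvolution_inv (star : G → G) (hmul : ∀ x y, star (x * y) = star y * star x)
    (hinv : Function.Involutive star) (x : G) : star x⁻¹ = (star x)⁻¹ := by
  refine eq_inv_of_mul_eq_one_right ?_
  rw [← hmul, inv_mul_cancel, antiInvolution_one star hmul hinv]

/-- If `Γ* ⊆ Γ` and `g* ∈ Γ g Γ` then `(Γ g Γ)* ⊆ Γ g Γ`. [folklore] -/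
theorem antiInvolution_mem_doubleCoset {Γ : Subgroup G} (star : G → G)
    (hmul : ∀ x y, star (x * y) = star y * star x) (hΓ : ∀ γ ∈ Γ, star γ ∈ Γ) {g a : G}
    (hg : star g ∈ DoubleCoset.doubleCoset g (Γ : Set G) Γ)
    (ha : a ∈ DoubleCoset.doubleCoset g (Γ : Set G) Γ) :
    star a ∈ DoubleCoset.doubleCoset g (Γ : Set G) Γ := by
  obtain ⟨u, hu, v, hv, rfl⟩ := DoubleCoset.mem_doubleCoset.mp ha
  rw [hmul, hmul, ← mul_assoc]
  exact mul_mem_doubleCoset (mem_doubleCoset_mul (hΓ v hv) hg) (hΓ u hu)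

/-! #### The key injection (Shimura 1971, proof of Prop. 3.8) -/

open scoped Classical in
/-- **Key inequality.** Let `Γ g Γ = ⊔ᵢ Γ αᵢ`, `Γ h Γ = ⊔ⱼ Γ βⱼ`, and let `*` be an
anti-involution of `G` with `Γ* ⊆ Γ`, `g* ∈ Γ g Γ`, `h* ∈ Γ h Γ` and `x* ∈ Γ x Γ`. Then
`#{j : x βⱼ⁻¹ ∈ Γ g Γ} ≤ #{i : x αᵢ⁻¹ ∈ Γ h Γ}`: writing `x* = γ₀ x δ₀`, the map sending `j` to
the index `i` of the right coset `Γ αᵢ ∋ (x βⱼ⁻¹)* δ₀⁻¹` is injective (this is the counting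
step in the proof of Shimura 1971, Prop. 3.8, made explicit). [folklore] -/
theorem card_le_card_of_antiInvolution {Γ : Subgroup G} {ι κ : Type*} [Fintype ι] [Fintype κ]
    {g h : G} {α : ι → G} {β : κ → G}
    (hα : IsDoubleCosetDecomp Γ Γ g α) (hβ : IsDoubleCosetDecomp Γ Γ h β)
    (star : G → G) (hmul : ∀ x y, star (x * y) = star y * star x)
    (hinv : Function.Involutive star) (hΓ : ∀ γ ∈ Γ, star γ ∈ Γ)
    (hg : star g ∈ DoubleCoset.doubleCoset g (Γ : Set G) Γ)
    (hh : star h ∈ DoubleCoset.doubleCoset h (Γ : Set G) Γ)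
    {x : G} (hx : star x ∈ DoubleCoset.doubleCoset x (Γ : Set G) Γ) :
    Fintype.card {j // x * (β j)⁻¹ ∈ DoubleCoset.doubleCoset g (Γ : Set G) Γ} ≤
      Fintype.card {i // x * (α i)⁻¹ ∈ DoubleCoset.doubleCoset h (Γ : Set G) Γ} := by
  classical
  obtain ⟨γ₀, hγ₀, δ₀, hδ₀, hx⟩ := DoubleCoset.mem_doubleCoset.mp hx
  -- the auxiliary elements `a' j = (x βⱼ⁻¹)* δ₀⁻¹ ∈ Γ g Γ`
  set a' : κ → G := fun j ↦ star (x * (β j)⁻¹) * δ₀⁻¹ with ha'_def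
  have ha' : ∀ j, x * (β j)⁻¹ ∈ DoubleCoset.doubleCoset g (Γ : Set G) Γ →
      a' j ∈ DoubleCoset.doubleCoset g (Γ : Set G) Γ := fun j hj ↦
    mul_mem_doubleCoset (antiInvolution_mem_doubleCoset star hmul hΓ hg hj) (Γ.inv_mem hδ₀)
  -- `x (a' j)⁻¹ = γ₀⁻¹ βⱼ*`
  have hxa' : ∀ j, x * (a' j)⁻¹ = γ₀⁻¹ * star (β j) := by
    intro j
    have h1 : x * δ₀ = γ₀⁻¹ * star x := by
      rw [hx]; group
    rw [ha'_def, mul_inv_rev, inv_inv, ← mul_assoc, h1, mul_assoc,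
      ← antiInvolution_inv star hmul hinv, ← hmul, mul_inv_rev, inv_inv, inv_mul_cancel_right]
  have hex : ∀ j : {j // x * (β j)⁻¹ ∈ DoubleCoset.doubleCoset g (Γ : Set G) Γ},
      ∃ i, a' j * (α i)⁻¹ ∈ Γ := fun j ↦ (hα.existsUnique _ (ha' j j.2)).exists
  choose Φ hΦ using hex
  have hΦmem : ∀ j, x * (α (Φ j))⁻¹ ∈ DoubleCoset.doubleCoset h (Γ : Set G) Γ := by
    intro j
    have : x * (α (Φ j))⁻¹ = x * (a' j)⁻¹ * (a' j * (α (Φ j))⁻¹) := by group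
    rw [this, hxa']
    exact mul_mem_doubleCoset (mem_doubleCoset_mul (Γ.inv_mem hγ₀)
      (antiInvolution_mem_doubleCoset star hmul hΓ hh (hβ.mem j))) (hΦ j)
  refine Fintype.card_le_of_injective
    (fun j ↦ (⟨Φ j, hΦmem j⟩ : {i // x * (α i)⁻¹ ∈ DoubleCoset.doubleCoset h (Γ : Set G) Γ}))
    fun j j' hjj' ↦ ?_
  have hi : Φ j = Φ j' := congrArg Subtype.val hjj'
  -- `a' j (a' j')⁻¹ ∈ Γ`
  have h1 : a' j * (a' j')⁻¹ ∈ Γ := by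
    have := Γ.mul_mem (hΦ j) (Γ.inv_mem (hΦ j'))
    rw [hi] at this
    convert this using 1
    group
  -- `a' j (a' j')⁻¹ = (β j' * (β j)⁻¹)*`
  have h2 : a' j * (a' j')⁻¹ = star (β j' * (β j)⁻¹) := by
    rw [ha'_def]
    simp only [mul_inv_rev, inv_inv]
    rw [mul_assoc, inv_mul_cancel_left, ← antiInvolution_inv star hmul hinv, ← hmul, mul_inv_rev,
      inv_inv, mul_assoc, inv_mul_cancel_left]
  rw [h2] at h1
  have h3 : β j' * (β j)⁻¹ ∈ Γ := by
    have := hΓ _ h1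
    rwa [hinv] at this
  exact Subtype.ext
    (hβ.eq_of_mul_inv_mem (hβ.mem j') h3 (by rw [mul_inv_cancel]; exact Γ.one_mem))

open scoped Classical in
/-- **Fibres of the product map.** If `Γ g Γ = ⊔ᵢ Γ αᵢ` then, for any family `β` and any `x`,
`#{(i, j) : Γ αᵢ βⱼ = Γ x} = #{j : x βⱼ⁻¹ ∈ Γ g Γ}` (for each such `j` there is exactly one `i`;
Shimura 1971, §3.1, discussion of (3.1.1)). [folklore] -/
theorem card_prod_eq_card {Γ : Subgroup G} {ι κ : Type*} [Fintype ι] [Fintype κ]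
    {g : G} {α : ι → G} (hα : IsDoubleCosetDecomp Γ Γ g α) (β : κ → G) (x : G) :
    Fintype.card {p : ι × κ // α p.1 * β p.2 * x⁻¹ ∈ Γ} =
      Fintype.card {j // x * (β j)⁻¹ ∈ DoubleCoset.doubleCoset g (Γ : Set G) Γ} := by
  have key : ∀ (i : ι) (j : κ), α i * β j * x⁻¹ ∈ Γ →
      x * (β j)⁻¹ ∈ DoubleCoset.doubleCoset g (Γ : Set G) Γ := by
    intro i j hij
    have : x * (β j)⁻¹ = (α i * β j * x⁻¹)⁻¹ * α i := by group
    rw [this]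
    exact mem_doubleCoset_mul (Γ.inv_mem hij) (hα.mem i)
  refine Fintype.card_congr
    { toFun := fun p ↦ ⟨p.1.2, key _ _ p.2⟩
      invFun := fun j ↦ ⟨((hα.existsUnique _ j.2).exists.choose, j.1), ?_⟩
      left_inv := ?_
      right_inv := ?_ }
  · have := (hα.existsUnique _ j.2).exists.choose_spec
    rw [← inv_mem_iff]
    convert this using 1
    group
  · rintro ⟨⟨i, j⟩, hij⟩
    simp only [Subtype.mk.injEq, Prod.mk.injEq, and_true]
    refine hα.eq_of_mul_inv_mem (key i j hij)
      (hα.existsUnique _ (key i j hij)).exists.choose_spec ?_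
    rw [← inv_mem_iff]
    convert hij using 1
    group
  · rintro ⟨j, hj⟩
    rfl

/-- **Shimura's commutativity criterion (Shimura 1971, Prop. 3.8), for a pair of double cosets.**
Let `Γ ≤ G`, let `Δ ⊇ Γ` be closed under multiplication, and let `*` be an anti-involution of `G`
(`(xy)* = y* x*`, `x** = x`) with `Γ* ⊆ Γ` and `x* ∈ Γ x Γ` for every `x ∈ Δ`. If `g, h ∈ Δ` and
`Γ g Γ = ⊔ᵢ Γ αᵢ`, `Γ h Γ = ⊔ⱼ Γ βⱼ` are finite decompositions, then the multisets of right cosets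
`{Γ αᵢ βⱼ}` and `{Γ βⱼ αᵢ}` coincide, i.e. `(Γ g Γ)(Γ h Γ) = (Γ h Γ)(Γ g Γ)` in `R(Γ, Δ)`.
(Shimura proves that the whole ring `R(Γ, Δ)` is then commutative; the present statement is the
same argument for two given double cosets, avoiding common representatives (his Lemma 3.5)
by counting `#{j : x βⱼ⁻¹ ∈ Γ g Γ}` directly.) [cite: Shimura1971, Prop. 3.8] -/
theorem exists_equiv_of_antiInvolution {Γ : Subgroup G} {ι κ : Type*}
    [Fintype ι] [Fintype κ] {g h : G} {α : ι → G} {β : κ → G}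
    (hα : IsDoubleCosetDecomp Γ Γ g α) (hβ : IsDoubleCosetDecomp Γ Γ h β)
    (star : G → G) (hmul : ∀ x y, star (x * y) = star y * star x)
    (hinv : Function.Involutive star) (hΓ : ∀ γ ∈ Γ, star γ ∈ Γ)
    {Δ : Set G} (hΓΔ : (Γ : Set G) ⊆ Δ) (hΔ : ∀ x ∈ Δ, ∀ y ∈ Δ, x * y ∈ Δ)
    (hstarΔ : ∀ x ∈ Δ, star x ∈ DoubleCoset.doubleCoset x (Γ : Set G) Γ)
    (hg : g ∈ Δ) (hh : h ∈ Δ) :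
    ∃ e : ι × κ ≃ κ × ι, ∀ i j, α i * β j * (β (e (i, j)).1 * α (e (i, j)).2)⁻¹ ∈ Γ := by
  classical
  -- Step 1: equal fibre cardinalities over every right coset `Γ x`.
  have hcard : ∀ x : G, Fintype.card {p : ι × κ // α p.1 * β p.2 * x⁻¹ ∈ Γ} =
      Fintype.card {p : κ × ι // β p.1 * α p.2 * x⁻¹ ∈ Γ} := by
    intro x
    rw [card_prod_eq_card hα β x, card_prod_eq_card hβ α x]
    by_cases hxΔ : x ∈ Δ
    · exact le_antisymm
        (card_le_card_of_antiInvolution hα hβ star hmul hinv hΓ (hstarΔ g hg) (hstarΔ h hh)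
          (hstarΔ x hxΔ))
        (card_le_card_of_antiInvolution hβ hα star hmul hinv hΓ (hstarΔ h hh) (hstarΔ g hg)
          (hstarΔ x hxΔ))
    · -- both index sets are empty
      have h1 : ∀ k y : G, k ∈ Δ → y ∈ Δ →
          x * y⁻¹ ∈ DoubleCoset.doubleCoset k (Γ : Set G) Γ → False := by
        intro k y hk hy hxy
        apply hxΔ
        have : x = x * y⁻¹ * y := by rw [inv_mul_cancel_right]
        rw [this]
        exact hΔ _ (doubleCoset_subset_of_mul_mem hΓΔ hΔ hk hxy) _ hy
      rw [Fintype.card_eq_zero_iff.mpr ⟨fun j ↦ h1 g (β j.1) hg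
          (doubleCoset_subset_of_mul_mem hΓΔ hΔ hh (hβ.mem j.1)) j.2⟩,
        Fintype.card_eq_zero_iff.mpr ⟨fun i ↦ h1 h (α i.1) hh
          (doubleCoset_subset_of_mul_mem hΓΔ hΔ hg (hα.mem i.1)) i.2⟩]
  -- Step 2: assemble a bijection fibrewise over the space of right cosets `Γ \ G`.
  let Q := Quotient (QuotientGroup.rightRel Γ)
  let s₁ : ι × κ → Q := fun p ↦ Quotient.mk _ (α p.1 * β p.2)
  let s₂ : κ × ι → Q := fun p ↦ Quotient.mk _ (β p.1 * α p.2)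
  have hfib : ∀ c : Q, Nonempty ({p // s₁ p = c} ≃ {p // s₂ p = c}) := by
    refine Quotient.ind fun x ↦ ⟨Fintype.equivOfCardEq ?_⟩
    have e₁ : {p // s₁ p = Quotient.mk _ x} ≃ {p : ι × κ // α p.1 * β p.2 * x⁻¹ ∈ Γ} :=
      Equiv.subtypeEquivRight fun p ↦ by
        simp only [s₁]
        rw [Quotient.eq, QuotientGroup.rightRel_apply, ← inv_mem_iff, mul_inv_rev, inv_inv]
    have e₂ : {p // s₂ p = Quotient.mk _ x} ≃ {p : κ × ι // β p.1 * α p.2 * x⁻¹ ∈ Γ} :=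
      Equiv.subtypeEquivRight fun p ↦ by
        simp only [s₂]
        rw [Quotient.eq, QuotientGroup.rightRel_apply, ← inv_mem_iff, mul_inv_rev, inv_inv]
    rw [Fintype.card_congr e₁, Fintype.card_congr e₂, hcard x]
  refine ⟨Equiv.ofFiberEquiv fun c ↦ (hfib c).some, fun i j ↦ ?_⟩
  have := Equiv.ofFiberEquiv_map (f := s₁) (g := s₂) (fun c ↦ (hfib c).some) (i, j)
  simp only [s₁, s₂] at this
  rw [Quotient.eq, QuotientGroup.rightRel_apply] at this
  exact this

end IsDoubleCosetDecomp

/-- **Shimura's commutativity criterion (Prop. 3.8), packaged**: under the hypotheses of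
`IsDoubleCosetDecomp.exists_equiv_of_antiInvolution`, if moreover the quotients
`Γ ⧸ (g⁻¹ Γ g ∩ Γ)` and `Γ ⧸ (h⁻¹ Γ h ∩ Γ)` are finite, the double cosets `Γ g Γ`, `Γ h Γ`
commute in the Hecke ring (`DoubleCosetsCommute Γ g h`). [cite: Shimura1971, Prop. 3.8] -/
theorem doubleCosetsCommute_of_antiInvolution {Γ : Subgroup G}
    (star : G → G) (hmul : ∀ x y, star (x * y) = star y * star x)
    (hinv : Function.Involutive star) (hΓ : ∀ γ ∈ Γ, star γ ∈ Γ)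
    {Δ : Set G} (hΓΔ : (Γ : Set G) ⊆ Δ) (hΔ : ∀ x ∈ Δ, ∀ y ∈ Δ, x * y ∈ Δ)
    (hstarΔ : ∀ x ∈ Δ, star x ∈ DoubleCoset.doubleCoset x (Γ : Set G) Γ)
    {g h : G} (hg : g ∈ Δ) (hh : h ∈ Δ)
    [Finite (Γ ⧸ (toConjAct g⁻¹ • Γ).subgroupOf Γ)]
    [Finite (Γ ⧸ (toConjAct h⁻¹ • Γ).subgroupOf Γ)] :
    DoubleCosetsCommute Γ g h := by
  obtain ⟨m, α, hα⟩ := exists_isDoubleCosetDecomp Γ Γ g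
  obtain ⟨n, β, hβ⟩ := exists_isDoubleCosetDecomp Γ Γ h
  exact ⟨Fin m, Fin n, inferInstance, inferInstance, α, β, hα, hβ,
    hα.exists_equiv_of_antiInvolution hβ star hmul hinv hΓ hΓΔ hΔ hstarΔ hg hh⟩

end Criterion

/-! ### Reduction of `heckeT_comm` to the commutativity of double cosets -/

section HeckeT

open CongruenceSubgroup

/-- The matrix `diag(1, p) ∈ GL(2, ℝ)` used in `heckeT Γ k p = [Γ diag(1, p) Γ]`. [folklore] -/
abbrev diagOneR (p : ℕ) [NeZero p] : GL (Fin 2) ℝ :=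
  glCast (diagGL 1 p one_pos (Nat.cast_pos.mpr (NeZero.pos p)) : GL (Fin 2) ℚ)

/-- `T_p T_q = T_q T_p` on `S_k(Γ)` as soon as the double cosets `Γ diag(1,p) Γ`, `Γ diag(1,q) Γ`
commute in the Hecke ring (Shimura 1971, Prop. 3.38). [cite: Shimura1971, Prop. 3.38] -/
theorem heckeT_comm_of_doubleCosetsCommute' (Γ : Subgroup (GL (Fin 2) ℝ)) [Γ.IsArithmetic]
    [Γ.HasDetOne] (k : ℤ) (p q : ℕ) [NeZero p] [NeZero q]
    (H : DoubleCosetsCommute Γ (diagOneR p) (diagOneR q)) :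
    heckeT Γ k p * heckeT Γ k q = heckeT Γ k q * heckeT Γ k p :=
  (cuspHeckeOperatorₗ_comm_of_doubleCosetsCommute Γ k _ _ H).symm

/-- `T_p T_q = T_q T_p` on `M_k(Γ)` as soon as the double cosets `Γ diag(1,p) Γ`, `Γ diag(1,q) Γ`
commute in the Hecke ring (Shimura 1971, Prop. 3.38). [cite: Shimura1971, Prop. 3.38] -/
theorem modHeckeT_comm_of_doubleCosetsCommute' (Γ : Subgroup (GL (Fin 2) ℝ)) [Γ.IsArithmetic]
    [Γ.HasDetOne] (k : ℤ) (p q : ℕ) [NeZero p] [NeZero q]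
    (H : DoubleCosetsCommute Γ (diagOneR p) (diagOneR q)) :
    modHeckeT Γ k p * modHeckeT Γ k q = modHeckeT Γ k q * modHeckeT Γ k p :=
  (heckeOperatorₗ_comm_of_doubleCosetsCommute Γ k _ _ H).symm

variable (N : ℕ) [NeZero N] (k : ℤ)

/-- **Reduction.** `heckeT_comm N k` (commutativity of all `T_p = [Γ₁(N) diag(1,p) Γ₁(N)]`,
`p ≥ 1`) follows from the commutativity of the double cosets `Γ₁(N) diag(1,p) Γ₁(N)` in the Hecke
ring (proved below as `gamma1_doubleCosetsCommute_diag`). [cite: Shimura1971, Prop. 3.38] -/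
theorem heckeT_comm_of_doubleCosetsCommute
    (H : ∀ p q : ℕ, [NeZero p] → [NeZero q] →
      DoubleCosetsCommute (Gamma1 N : Subgroup (GL (Fin 2) ℝ)) (diagOneR p) (diagOneR q)) :
    heckeT_comm N k :=
  fun p q _ _ ↦ heckeT_comm_of_doubleCosetsCommute' _ k p q (H p q)


end HeckeT

/-! ### `Γ₁(N)`-double cosets of integer matrices (Shimura Prop. 3.32(1) for `n = 2`) -/

namespace HeckeTComm

section IntArith

open Matrix

/-- **Making a row primitive by a unipotent row operation.** If `(a b; c d)` is a primitive integer
matrix (`gcd(a,b,c,d) = 1`) with `ad - bc ≠ 0`, then `gcd(a + sc, b + sd) = 1` for some `s ∈ ℤ`;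
explicitly `s = ∏ p` over the primes `p ∣ ad - bc` not dividing both `a` and `b` (any common prime
of `a + sc, b + sd` divides `(a+sc)d - (b+sd)c = ad - bc`; if `p ∤ gcd(a,b)` then `p ∣ s` forces
`p ∣ a, b`; if `p ∣ a, b` then `p ∤ s` and `p ∣ sc, sd` forces `p ∣ c, d`). This is the elementary
step replacing the appeal to `SL₂(ℤ) → SL₂(ℤ/Mℤ)` (Shimura 1971, Lemma 1.38) in the proof of
Shimura's Prop. 3.32. [folklore] -/
theorem exists_isCoprime_add_mul {a b c d : ℤ} (hdet : a * d - b * c ≠ 0)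
    (hprim : ∀ p : ℕ, p.Prime → (p : ℤ) ∣ a → (p : ℤ) ∣ b → (p : ℤ) ∣ c → ¬ (p : ℤ) ∣ d) :
    ∃ s : ℤ, IsCoprime (a + s * c) (b + s * d) := by
  classical
  set T : Finset ℕ := (a * d - b * c).natAbs.primeFactors.filter
    (fun p : ℕ ↦ ¬ ((p : ℤ) ∣ a ∧ (p : ℤ) ∣ b)) with hT
  set s : ℤ := ∏ p ∈ T, (p : ℤ) with hs
  refine ⟨s, ?_⟩
  rw [Int.isCoprime_iff_gcd_eq_one, Int.gcd_eq_natAbs]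
  refine Nat.coprime_of_dvd fun p hp hpa hpb ↦ ?_
  rw [← Int.natCast_dvd] at hpa hpb
  have hpZ : Prime (p : ℤ) := Nat.prime_iff_prime_int.mp hp
  have hpD : (p : ℤ) ∣ a * d - b * c := by
    have : a * d - b * c = (a + s * c) * d - (b + s * d) * c := by ring
    rw [this]
    exact dvd_sub (dvd_mul_of_dvd_left hpa d) (dvd_mul_of_dvd_left hpb c)
  by_cases hab : (p : ℤ) ∣ a ∧ (p : ℤ) ∣ b
  · -- `p ∉ T`, hence `p ∤ s`, hence `p ∣ c` and `p ∣ d`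
    have hps : ¬ (p : ℤ) ∣ s := by
      intro h
      rw [hs, hpZ.dvd_finsetProd_iff] at h
      obtain ⟨q, hqT, hpq⟩ := h
      rw [Int.natCast_dvd_natCast] at hpq
      obtain ⟨hq, -⟩ := Finset.mem_filter.mp hqT
      have hq' : q.Prime := Nat.prime_of_mem_primeFactors hq
      have : p = q := (Nat.prime_dvd_prime_iff_eq hp hq').mp hpq
      subst this
      exact (Finset.mem_filter.mp hqT).2 hab
    have hpc : (p : ℤ) ∣ c := by
      have h1 : (p : ℤ) ∣ s * c := by
        have := dvd_sub hpa hab.1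
        rwa [add_sub_cancel_left] at this
      exact (hpZ.dvd_or_dvd h1).resolve_left hps
    have hpd : (p : ℤ) ∣ d := by
      have h1 : (p : ℤ) ∣ s * d := by
        have := dvd_sub hpb hab.2
        rwa [add_sub_cancel_left] at this
      exact (hpZ.dvd_or_dvd h1).resolve_left hps
    exact hprim p hp hab.1 hab.2 hpc hpd
  · -- `p ∈ T`, hence `p ∣ s`, hence `p ∣ a` and `p ∣ b`
    have hpT : p ∈ T := by
      refine Finset.mem_filter.mpr ⟨Nat.mem_primeFactors.mpr ⟨hp, ?_, ?_⟩, hab⟩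
      · exact Int.natCast_dvd.mp hpD
      · exact Int.natAbs_ne_zero.mpr hdet
    have hps : (p : ℤ) ∣ s := Finset.dvd_prod_of_mem _ hpT
    refine hab ⟨?_, ?_⟩
    · have := dvd_sub hpa (dvd_mul_of_dvd_left hps c)
      rwa [add_sub_cancel_right] at this
    · have := dvd_sub hpb (dvd_mul_of_dvd_left hps d)
      rwa [add_sub_cancel_right] at this

/-- The (positive) gcd of the entries of a `2 × 2` integer matrix of nonzero determinant, with its
characteristic properties. [folklore] -/
theorem exists_gcd_entries (X : Matrix (Fin 2) (Fin 2) ℤ) (hX : X.det ≠ 0) :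
    ∃ e : ℤ, 0 < e ∧ (∀ i j, e ∣ X i j) ∧ (∀ f : ℤ, (∀ i j, f ∣ X i j) → f ∣ e) := by
  refine ⟨Int.gcd (Int.gcd (X 0 0) (X 0 1)) (Int.gcd (X 1 0) (X 1 1)), ?_, ?_, ?_⟩
  · refine Int.natCast_pos.mpr (Int.gcd_pos_iff.mpr (Or.inl ?_))
    intro h
    rw [Int.natCast_eq_zero, Int.gcd_eq_zero_iff] at h
    apply hX
    rw [Matrix.det_fin_two, h.1, h.2]
    ring
  · intro i j
    fin_cases i <;> fin_cases j
    · exact (Int.gcd_dvd_left ..).trans (Int.gcd_dvd_left ..)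
    · exact (Int.gcd_dvd_left ..).trans (Int.gcd_dvd_right ..)
    · exact (Int.gcd_dvd_right ..).trans (Int.gcd_dvd_left ..)
    · exact (Int.gcd_dvd_right ..).trans (Int.gcd_dvd_right ..)
  · intro f hf
    exact Int.dvd_coe_gcd (Int.dvd_coe_gcd (hf 0 0) (hf 0 1)) (Int.dvd_coe_gcd (hf 1 0) (hf 1 1))

open scoped MatrixGroups in
open CongruenceSubgroup in
/-- **Reduction to diagonal form** (the `2 × 2` case of the argument in Shimura 1971, proof of
Prop. 3.32, for `Γ' = Γ₁(N)`, `t = 1`). Let `X ∈ M₂(ℤ)` with `det X ≠ 0`,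
`N ∣ X₁₀` and `gcd(X₀₀, N) = 1`, and let `e = gcd` of the entries of `X`. Then there are
`γ ∈ Γ₁(N)` and `δ ∈ Γ₀(N)` with `γ X δ = diag(e, det X / e)` and `δ₁₁ e ≡ X₀₀ (mod N)`.
Construction: `γ = (1 0; -C 1)(1 s; 0 1)` with `s` as in `exists_isCoprime_add_mul` (making the
first row `(eA', eB')` with `gcd(A', B') = 1`) and `δ = (u -B'; Nv A')`, `uA' + vNB' = 1`.
[cite: Shimura1971, Prop. 3.32(1) (proof)] -/
theorem exists_gamma1_mul_mul_gamma0_eq_diagonal (N : ℕ) (X : Matrix (Fin 2) (Fin 2) ℤ)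
    (hX : X.det ≠ 0) (hc : (N : ℤ) ∣ X 1 0) (ha : IsCoprime (X 0 0) N) :
    ∃ (γ δ : SL(2, ℤ)) (e d : ℤ), γ ∈ Gamma1 N ∧ δ ∈ Gamma0 N ∧ 0 < e ∧
      (γ : Matrix (Fin 2) (Fin 2) ℤ) * X * δ = !![e, 0; 0, d] ∧
      (∀ i j, e ∣ X i j) ∧ (∀ f : ℤ, (∀ i j, f ∣ X i j) → f ∣ e) ∧
      (((δ 1 1 * e : ℤ) : ZMod N) = X 0 0) := by
  obtain ⟨e, he0, hediv, hemax⟩ := exists_gcd_entries X hX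
  have he : e ≠ 0 := he0.ne'
  obtain ⟨a', ha'⟩ := hediv 0 0
  obtain ⟨b', hb'⟩ := hediv 0 1
  obtain ⟨c', hc'⟩ := hediv 1 0
  obtain ⟨d', hd'⟩ := hediv 1 1
  -- the quotient matrix `(a' b'; c' d')` is primitive with nonzero determinant
  have hdetX : X.det = e ^ 2 * (a' * d' - b' * c') := by
    rw [Matrix.det_fin_two, ha', hb', hc', hd']; ring
  have hdet' : a' * d' - b' * c' ≠ 0 := by
    intro h; apply hX; rw [hdetX, h, mul_zero]
  have hprim : ∀ p : ℕ, p.Prime → (p : ℤ) ∣ a' → (p : ℤ) ∣ b' → (p : ℤ) ∣ c' →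
      ¬ (p : ℤ) ∣ d' := by
    intro p hp hpa hpb hpc hpd
    have h1 : (p : ℤ) * e ∣ e := by
      refine hemax _ fun i j ↦ ?_
      rw [mul_comm (p : ℤ) e]
      fin_cases i <;> fin_cases j
      · show e * p ∣ X 0 0
        rw [ha']; exact mul_dvd_mul_left e hpa
      · show e * p ∣ X 0 1
        rw [hb']; exact mul_dvd_mul_left e hpb
      · show e * p ∣ X 1 0
        rw [hc']; exact mul_dvd_mul_left e hpc
      · show e * p ∣ X 1 1
        rw [hd']; exact mul_dvd_mul_left e hpd
    have h2 : (p : ℤ) ∣ 1 := by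
      have : (p : ℤ) * e ∣ 1 * e := by rwa [one_mul]
      exact (mul_dvd_mul_iff_right he).mp this
    exact hp.one_lt.ne' (by exact_mod_cast Int.eq_one_of_dvd_one (by positivity) h2)
  obtain ⟨s, hAB⟩ := exists_isCoprime_add_mul hdet' hprim
  -- `e` and `A' = a' + s c'` are prime to `N`
  have heN : IsCoprime e N := by
    rw [ha'] at ha
    exact IsCoprime.of_mul_left_left ha
  have hcN : (N : ℤ) ∣ c' := by
    rw [hc'] at hc
    exact heN.symm.dvd_of_dvd_mul_left hc
  obtain ⟨c'', hc''⟩ := hcN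
  have hA'N : IsCoprime (a' + s * c') N := by
    rw [ha'] at ha
    have h1 : IsCoprime a' N := IsCoprime.of_mul_left_right ha
    have : a' + s * c' = a' + N * (s * c'') := by rw [hc'']; ring
    rw [this]
    exact h1.add_mul_left_left _
  -- Bezout for `A'` and `N B'`
  obtain ⟨u, v, huv⟩ : IsCoprime (a' + s * c') (N * (b' + s * d')) := hA'N.mul_right hAB
  -- the matrices
  let Ts : SL(2, ℤ) := ⟨!![1, s; 0, 1], by rw [Matrix.det_fin_two_of]; ring⟩
  let δ : SL(2, ℤ) := ⟨!![u, -(b' + s * d'); N * v, a' + s * c'], by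
    rw [Matrix.det_fin_two_of]; linear_combination huv⟩
  -- the lower left entry of `Ts X δ` is `e C` with `N ∣ C`
  have hCN : (N : ℤ) ∣ c' * u + d' * (N * v) := by
    rw [hc'']
    exact dvd_add (dvd_mul_of_dvd_left (dvd_mul_right _ _) _)
      (dvd_mul_of_dvd_right (dvd_mul_right _ _) _)
  obtain ⟨C', hC'⟩ := hCN
  let γ₂ : SL(2, ℤ) := ⟨!![1, 0; -(c' * u + d' * (N * v)), 1], by rw [Matrix.det_fin_two_of]; ring⟩
  refine ⟨γ₂ * Ts, δ, e, e * (-(c' * (b' + s * d')) + d' * (a' + s * c')), ?_, ?_, he0, ?_,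
    hediv, hemax, ?_⟩
  · -- `γ₂ Ts ∈ Γ₁(N)`
    refine Subgroup.mul_mem _ ?_ ?_
    · rw [Gamma1_mem]
      refine ⟨by simp [γ₂], by simp [γ₂], ?_⟩
      simp only [γ₂, Matrix.of_apply, Matrix.cons_val', Matrix.cons_val_zero, Matrix.cons_val_one,
        Matrix.empty_val', Matrix.cons_val_fin_one, hC', Int.cast_neg, Int.cast_mul,
        Int.cast_natCast, ZMod.natCast_self, zero_mul, neg_zero]
    · rw [Gamma1_mem]
      exact ⟨by simp [Ts], by simp [Ts], by simp [Ts]⟩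
  · -- `δ ∈ Γ₀(N)`
    rw [Gamma0_mem]
    simp [δ]
  · -- the matrix identity
    have hXe : X = !![e * a', e * b'; e * c', e * d'] := by
      rw [← ha', ← hb', ← hc', ← hd']
      exact Matrix.eta_fin_two X
    have hM₁ : (Ts : Matrix (Fin 2) (Fin 2) ℤ) * X * δ =
        !![e, 0; e * (c' * u + d' * (N * v)),
          e * (-(c' * (b' + s * d')) + d' * (a' + s * c'))] := by
      rw [hXe]
      ext i j
      fin_cases i <;> fin_cases j
      · simp [Ts, δ, Matrix.mul_apply, Fin.sum_univ_two]
        linear_combination e * huv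
      · simp [Ts, δ, Matrix.mul_apply, Fin.sum_univ_two]
        ring
      · simp [Ts, δ, Matrix.mul_apply, Fin.sum_univ_two]
        ring
      · simp [Ts, δ, Matrix.mul_apply, Fin.sum_univ_two]
        ring
    rw [Matrix.SpecialLinearGroup.coe_mul, Matrix.mul_assoc, Matrix.mul_assoc,
      ← Matrix.mul_assoc _ X, hM₁]
    ext i j
    fin_cases i <;> fin_cases j <;> simp [γ₂, Matrix.mul_apply, Fin.sum_univ_two]
    ring
  · -- the congruence `δ₁₁ e ≡ X₀₀ (mod N)`
    have h1 : (δ 1 1 : ℤ) = a' + s * c' := rfl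
    rw [h1, ha']
    have : (a' + s * c') * e - e * a' = N * (e * s * c'') := by rw [hc'']; ring
    rw [ZMod.intCast_eq_intCast_iff_dvd_sub]
    exact ⟨-(e * s * c''), by linear_combination -this⟩

open scoped MatrixGroups in
open CongruenceSubgroup in
/-- **`Γ₁(N)`-double cosets of integer matrices are determined by the determinant, the gcd of the
entries and the upper left entry mod `N`.** If `X, Y ∈ M₂(ℤ)` have the same nonzero determinant,
lower left entries divisible by `N`, upper left entries prime to `N` and congruent to each other
mod `N`, and the same common divisors of their entries, then `Y = γ X δ` with `γ, δ ∈ Γ₁(N)`.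
This is the `2 × 2` case of Shimura 1971, Prop. 3.32(1) (`Γ' α Γ' = {β ∈ Δ' : det β = det α,
E_p β E_p = E_p α E_p ∀ p ∣ q}` for `Γ'`, `Δ'` as in (3.3.2), (3.3.3); with `t = 1` and `𝔥 = {1}`,
i.e. `Γ' = Γ₁(N)` and upper left entries `≡ 1 (N)`; for `2 × 2` matrices the local double cosets
`E_p β E_p`, `E_p = GL₂(ℤ_p)`, are given by `det β` and the gcd of the entries), in the slightly
more flexible form allowing any common unit upper left entry mod `N`; it is proved directly by the
row and column reduction `exists_gamma1_mul_mul_gamma0_eq_diagonal`.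
[cite: Shimura1971, Prop. 3.32(1)] -/
theorem exists_gamma1_mul_mul_gamma1_eq (N : ℕ) {X Y : Matrix (Fin 2) (Fin 2) ℤ}
    (hX : X.det ≠ 0) (hdet : Y.det = X.det) (hXc : (N : ℤ) ∣ X 1 0) (hYc : (N : ℤ) ∣ Y 1 0)
    (hXa : IsCoprime (X 0 0) N) (hYa : IsCoprime (Y 0 0) N)
    (ha : ((Y 0 0 : ℤ) : ZMod N) = X 0 0)
    (hdiv : ∀ f : ℤ, (∀ i j, f ∣ X i j) ↔ (∀ i j, f ∣ Y i j)) :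
    ∃ γ δ : SL(2, ℤ), γ ∈ Gamma1 N ∧ δ ∈ Gamma1 N ∧
      Y = (γ : Matrix (Fin 2) (Fin 2) ℤ) * X * δ := by
  have hY : Y.det ≠ 0 := hdet ▸ hX
  obtain ⟨γ, δ, e, d, hγ, hδ, he0, hXeq, hediv, hemax, hcong⟩ :=
    exists_gamma1_mul_mul_gamma0_eq_diagonal N X hX hXc hXa
  obtain ⟨γ', δ', e', d', hγ', hδ', he0', hYeq, hediv', hemax', hcong'⟩ :=
    exists_gamma1_mul_mul_gamma0_eq_diagonal N Y hY hYc hYa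
  -- `e = e'`
  have hee' : e = e' := by
    refine Int.dvd_antisymm he0.le he0'.le ?_ ?_
    · exact hemax' e ((hdiv e).mp hediv)
    · exact hemax e' ((hdiv e').mpr hediv')
  subst hee'
  -- `d = d'` by comparing determinants
  have hdd' : d = d' := by
    have h1 : X.det = e * d := by
      have := congrArg Matrix.det hXeq
      simpa [Matrix.det_mul, Matrix.det_fin_two_of] using this
    have h2 : Y.det = e * d' := by
      have := congrArg Matrix.det hYeq
      simpa [Matrix.det_mul, Matrix.det_fin_two_of] using this
    have : e * d = e * d' := by rw [← h1, ← h2, hdet]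
    exact mul_left_cancel₀ he0.ne' this
  subst hdd'
  -- `δ δ'⁻¹ ∈ Γ₁(N)`
  have hδδ' : δ * δ'⁻¹ ∈ Gamma1 N := by
    rw [Gamma0_mem] at hδ hδ'
    have hd : (((δ : Matrix (Fin 2) (Fin 2) ℤ).det : ℤ) : ZMod N) = 1 := by
      rw [Matrix.SpecialLinearGroup.det_coe, Int.cast_one]
    have hd' : (((δ' : Matrix (Fin 2) (Fin 2) ℤ).det : ℤ) : ZMod N) = 1 := by
      rw [Matrix.SpecialLinearGroup.det_coe, Int.cast_one]
    rw [Matrix.det_fin_two] at hd hd'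
    push_cast at hd hd' hδ hδ'
    rw [hδ, mul_zero, sub_zero] at hd
    rw [hδ', mul_zero, sub_zero] at hd'
    -- `e` is a unit mod `N`, so `δ₁₁ ≡ δ'₁₁`
    have heN : IsCoprime e N := by
      obtain ⟨a', ha'⟩ := hediv 0 0
      rw [ha'] at hXa
      exact IsCoprime.of_mul_left_left hXa
    obtain ⟨p, q, hpq⟩ := heN
    have heu : (p : ZMod N) * e = 1 := by
      have := congrArg (fun z : ℤ ↦ (z : ZMod N)) hpq
      simpa using this
    have h11 : ((δ 1 1 : ℤ) : ZMod N) = (δ' 1 1 : ℤ) := by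
      push_cast at hcong hcong'
      have := congrArg (· * (p : ZMod N)) (hcong.trans (ha.symm.trans hcong'.symm))
      simpa [mul_assoc, mul_comm (e : ZMod N), heu] using this
    rw [Gamma1_mem]
    simp only [Matrix.SpecialLinearGroup.coe_mul, Matrix.SpecialLinearGroup.coe_inv,
      Matrix.adjugate_fin_two, Matrix.mul_apply, Fin.sum_univ_two, Matrix.of_apply,
      Matrix.cons_val', Matrix.cons_val_zero, Matrix.cons_val_one, Matrix.empty_val',
      Matrix.cons_val_fin_one]
    push_cast
    refine ⟨?_, ?_, ?_⟩
    · rw [hδ', neg_zero, mul_zero, add_zero, ← h11, hd]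
    · rw [hδ, zero_mul, zero_add, h11, mul_comm, hd']
    · rw [hδ, hδ', zero_mul, neg_zero, mul_zero, add_zero]
  refine ⟨γ'⁻¹ * γ, δ * δ'⁻¹, Subgroup.mul_mem _ (Subgroup.inv_mem _ hγ') hγ, hδδ', ?_⟩
  -- `Y = γ'⁻¹ γ X δ δ'⁻¹`
  have h1 : (γ' : Matrix (Fin 2) (Fin 2) ℤ) * Y * δ' = γ * X * δ := by rw [hYeq, hXeq]
  have hγ'inv : ((γ'⁻¹ : SL(2, ℤ)) : Matrix (Fin 2) (Fin 2) ℤ) * γ' = 1 := by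
    rw [← Matrix.SpecialLinearGroup.coe_mul, inv_mul_cancel, Matrix.SpecialLinearGroup.coe_one]
  have hδ'inv : (δ' : Matrix (Fin 2) (Fin 2) ℤ) * ((δ'⁻¹ : SL(2, ℤ)) : Matrix (Fin 2) (Fin 2) ℤ) =
      1 := by
    rw [← Matrix.SpecialLinearGroup.coe_mul, mul_inv_cancel, Matrix.SpecialLinearGroup.coe_one]
  calc Y = ((γ'⁻¹ : SL(2, ℤ)) : Matrix (Fin 2) (Fin 2) ℤ) * ((γ' : Matrix (Fin 2) (Fin 2) ℤ) *
        Y * δ') * ((δ'⁻¹ : SL(2, ℤ)) : Matrix (Fin 2) (Fin 2) ℤ) := by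
        rw [show ((γ'⁻¹ : SL(2, ℤ)) : Matrix (Fin 2) (Fin 2) ℤ) * ((γ' : Matrix (Fin 2) (Fin 2) ℤ)
            * Y * δ') * ((δ'⁻¹ : SL(2, ℤ)) : Matrix (Fin 2) (Fin 2) ℤ) =
            (((γ'⁻¹ : SL(2, ℤ)) : Matrix (Fin 2) (Fin 2) ℤ) * γ') * Y *
            ((δ' : Matrix (Fin 2) (Fin 2) ℤ) * ((δ'⁻¹ : SL(2, ℤ)) : Matrix (Fin 2) (Fin 2) ℤ)) by
            simp only [Matrix.mul_assoc], hγ'inv, hδ'inv, Matrix.one_mul, Matrix.mul_one]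
    _ = _ := by
        rw [h1, Matrix.SpecialLinearGroup.coe_mul, Matrix.SpecialLinearGroup.coe_mul]
        simp only [Matrix.mul_assoc]

/-- The integer matrix `X* = (a, c/N; Nb, d)` attached to `X = (a b; c d)` with `c = N c'` has the
same determinant as `X`. [folklore] -/
theorem det_starMatrix (N : ℤ) (X : Matrix (Fin 2) (Fin 2) ℤ) (c' : ℤ) (hc : X 1 0 = N * c') :
    (!![X 0 0, c'; N * X 0 1, X 1 1] : Matrix (Fin 2) (Fin 2) ℤ).det = X.det := by
  rw [Matrix.det_fin_two_of, Matrix.det_fin_two, hc]; ring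

/-- `X = (a b; c d)` with `c = N c'`, `gcd(a, N) = 1`, and `X* = (a, c'; Nb, d)` have the same
common divisors of their entries (any common divisor divides `a`, so is prime to `N`). [folklore] -/
theorem dvd_starMatrix_iff (N : ℤ) (X : Matrix (Fin 2) (Fin 2) ℤ) (c' : ℤ) (hc : X 1 0 = N * c')
    (ha : IsCoprime (X 0 0) N) (f : ℤ) :
    (∀ i j, f ∣ X i j) ↔
      ∀ i j, f ∣ (!![X 0 0, c'; N * X 0 1, X 1 1] : Matrix (Fin 2) (Fin 2) ℤ) i j := by
  constructor
  · intro h i j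
    have hfN : IsCoprime f N := by
      obtain ⟨t, ht⟩ := h 0 0
      rw [ht] at ha
      exact IsCoprime.of_mul_left_left ha
    fin_cases i <;> fin_cases j
    · simpa using h 0 0
    · have := h 1 0
      rw [hc, mul_comm] at this
      simpa using hfN.dvd_of_dvd_mul_right this
    · simpa using dvd_mul_of_dvd_right (h 0 1) N
    · simpa using h 1 1
  · intro h i j
    have h00 : f ∣ X 0 0 := by simpa using h 0 0
    have hfN : IsCoprime f N := by
      obtain ⟨t, ht⟩ := h00
      rw [ht] at ha
      exact IsCoprime.of_mul_left_left ha
    fin_cases i <;> fin_cases j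
    · exact h00
    · have := h 1 0
      simp at this
      rw [mul_comm] at this
      exact hfN.dvd_of_dvd_mul_right this
    · have := h 0 1
      simp at this
      simp only [Fin.mk_one, Fin.isValue, Fin.zero_eta, hc]
      exact dvd_mul_of_dvd_right this N
    · simpa using h 1 1

open scoped MatrixGroups in
open CongruenceSubgroup in
/-- **`X* ∈ Γ₁(N) X Γ₁(N)`**: if `X ∈ M₂(ℤ)` has `det X ≠ 0`, `X₁₀ = N c'` and
`gcd(X₀₀, N) = 1`, then `X* = (X₀₀, c'; N X₀₁, X₁₁) = γ X δ` for some `γ, δ ∈ Γ₁(N)`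
(a consequence of Shimura 1971, Prop. 3.32(1): `X` and `X*` have the same invariants).
[cite: Shimura1971, Prop. 3.32(1)] -/
theorem exists_gamma1_starMatrix_eq (N : ℕ) (X : Matrix (Fin 2) (Fin 2) ℤ) (hX : X.det ≠ 0)
    (c' : ℤ) (hc : X 1 0 = N * c') (ha : IsCoprime (X 0 0) N) :
    ∃ γ δ : SL(2, ℤ), γ ∈ Gamma1 N ∧ δ ∈ Gamma1 N ∧
      (!![X 0 0, c'; N * X 0 1, X 1 1] : Matrix (Fin 2) (Fin 2) ℤ) =
        (γ : Matrix (Fin 2) (Fin 2) ℤ) * X * δ :=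
  exists_gamma1_mul_mul_gamma1_eq N hX (det_starMatrix N X c' hc) ⟨c', hc⟩
    ⟨X 0 1, by simp⟩ ha (by simpa using ha) (by simp) (dvd_starMatrix_iff N X c' hc ha)

end IntArith

/-! ### The anti-involution `x ↦ diag(1,N) xᵀ diag(1,N)⁻¹` of `GL(2, ℝ)`; `Γ₁(N)* = Γ₁(N)` -/

section Star

open Matrix CongruenceSubgroup Matrix.SpecialLinearGroup

variable (N : ℕ) [NeZero N] (star : GL (Fin 2) ℝ → GL (Fin 2) ℝ)
  (hstar : ∀ x : GL (Fin 2) ℝ, ((star x : GL (Fin 2) ℝ) : Matrix (Fin 2) (Fin 2) ℝ) =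
    !![x 0 0, x 1 0 / N; N * x 0 1, x 1 1])

include hstar

/-- `x ↦ x* = diag(1,N) xᵀ diag(1,N)⁻¹ = (x₀₀, x₁₀/N; N x₀₁, x₁₁)` is an anti-homomorphism of
`GL(2, ℝ)`. [folklore] -/
theorem star_mul_eq (x y : GL (Fin 2) ℝ) : star (x * y) = star y * star x := by
  have hN : (N : ℝ) ≠ 0 := by exact_mod_cast NeZero.ne N
  refine Matrix.GeneralLinearGroup.ext fun i j ↦ ?_
  rw [Matrix.GeneralLinearGroup.coe_mul, hstar, hstar, hstar]
  simp only [Matrix.GeneralLinearGroup.coe_mul]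
  fin_cases i <;> fin_cases j <;> simp [Matrix.mul_apply, Fin.sum_univ_two] <;> field_simp

/-- `x ↦ x*` is an involution. [folklore] -/
theorem star_involutive : Function.Involutive star := by
  have hN : (N : ℝ) ≠ 0 := by exact_mod_cast NeZero.ne N
  intro x
  refine Matrix.GeneralLinearGroup.ext fun i j ↦ ?_
  rw [hstar]
  have h := hstar x
  have h00 : (star x) 0 0 = x 0 0 := by
    simpa using congrFun (congrFun h 0) 0
  have h01 : (star x) 0 1 = x 1 0 / N := by
    simpa using congrFun (congrFun h 0) 1
  have h10 : (star x) 1 0 = N * x 0 1 := by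
    simpa using congrFun (congrFun h 1) 0
  have h11 : (star x) 1 1 = x 1 1 := by
    simpa using congrFun (congrFun h 1) 1
  fin_cases i <;> fin_cases j <;> simp [h00, h01, h10, h11] <;> field_simp

/-- On the image of `SL₂(ℤ)`: for `γ = (a b; c d)` with `c = N c'`, `γ* = (a, c'; Nb, d)` is again
the image of an element of `SL₂(ℤ)`. [folklore] -/
theorem star_mapGL (γ : SL(2, ℤ)) (c' : ℤ) (hc' : γ 1 0 = N * c') :
    star (mapGL ℝ γ) = mapGL ℝ ⟨!![γ 0 0, c'; N * γ 0 1, γ 1 1],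
      by rw [det_starMatrix (N : ℤ) γ c' hc', Matrix.SpecialLinearGroup.det_coe]⟩ := by
  have hN : (N : ℝ) ≠ 0 := by exact_mod_cast NeZero.ne N
  refine Matrix.GeneralLinearGroup.ext fun i j ↦ ?_
  rw [hstar, mapGL_coe_matrix]
  simp only [mapGL_coe_matrix, algebraMap_int_eq]
  have hN' : (γ 1 0 : ℝ) = N * c' := by exact_mod_cast hc'
  fin_cases i <;> fin_cases j <;> simp [hN']
  field_simp

/-- `Γ₁(N)* = Γ₁(N)`: for `γ = (a b; c d) ∈ Γ₁(N)`, `γ* = (a, c/N; Nb, d) ∈ Γ₁(N)`. [folklore] -/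
theorem star_mem_gamma1 {x : GL (Fin 2) ℝ} (hx : x ∈ (Gamma1 N : Subgroup (GL (Fin 2) ℝ))) :
    star x ∈ (Gamma1 N : Subgroup (GL (Fin 2) ℝ)) := by
  obtain ⟨γ, hγ, rfl⟩ := Subgroup.mem_map.mp hx
  obtain ⟨h00, h11, h10⟩ := (Gamma1_mem N γ).mp hγ
  obtain ⟨c', hc'⟩ := (ZMod.intCast_zmod_eq_zero_iff_dvd _ N).mp h10
  rw [star_mapGL N star hstar γ c' hc']
  refine Subgroup.mem_map_of_mem _ ((Gamma1_mem N _).mpr ⟨?_, ?_, ?_⟩)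
  · simpa using h00
  · simpa using h11
  · simp

/-- `Γ₀(N)* = Γ₀(N)`: for `γ = (a b; c d) ∈ Γ₀(N)`, `γ* = (a, c/N; Nb, d) ∈ Γ₀(N)`. [folklore] -/
theorem star_mem_gamma0 {x : GL (Fin 2) ℝ} (hx : x ∈ (Gamma0 N : Subgroup (GL (Fin 2) ℝ))) :
    star x ∈ (Gamma0 N : Subgroup (GL (Fin 2) ℝ)) := by
  obtain ⟨γ, hγ, rfl⟩ := Subgroup.mem_map.mp hx
  have h10 : ((γ 1 0 : ℤ) : ZMod N) = 0 := Gamma0_mem.mp hγ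
  obtain ⟨c', hc'⟩ := (ZMod.intCast_zmod_eq_zero_iff_dvd _ N).mp h10
  rw [star_mapGL N star hstar γ c' hc']
  refine Subgroup.mem_map_of_mem _ (Gamma0_mem.mpr ?_)
  simp

end Star

/-! ### The semigroup `Δ₀(N)`, the concrete anti-involution, and the discharges -/

section Assembly

open Matrix CongruenceSubgroup Matrix.SpecialLinearGroup

variable (N : ℕ) [NeZero N]

/-- The anti-involution `x ↦ x* = diag(1,N) xᵀ diag(1,N)⁻¹ = (x₀₀, x₁₀/N; N x₀₁, x₁₁)` of
`GL(2, ℝ)` as a concrete map (its determinant is `det x ≠ 0`). [folklore] -/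
def starGL (x : GL (Fin 2) ℝ) : GL (Fin 2) ℝ :=
  Matrix.GeneralLinearGroup.mkOfDetNeZero !![x 0 0, x 1 0 / N; N * x 0 1, x 1 1] (by
    have hN : (N : ℝ) ≠ 0 := by exact_mod_cast NeZero.ne N
    have hx := Matrix.GeneralLinearGroup.det_ne_zero x
    rw [Matrix.det_fin_two] at hx
    rw [Matrix.det_fin_two_of]
    convert hx using 1
    field_simp)

/-- The underlying matrix of `starGL N x`. [folklore] -/
lemma val_starGL (x : GL (Fin 2) ℝ) :
    ((starGL N x : GL (Fin 2) ℝ) : Matrix (Fin 2) (Fin 2) ℝ) =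
      !![x 0 0, x 1 0 / N; N * x 0 1, x 1 1] :=
  rfl

omit [NeZero N] in
/-- The auxiliary semigroup `Δ₀(N) ⊆ GL(2, ℝ)`: images of integer matrices `X = (a b; c d)`
(necessarily of nonzero determinant) with `N ∣ c` and `gcd(a, N) = 1` (compare Shimura's `Δ'` of
(3.3.3) with `𝔥 = (ℤ/Nℤ)ˣ`, `t = 1`, which in addition asks `det X > 0`). It contains `Γ₀(N)`,
hence `Γ₁(N)`, and every `diag(1, m)`, `m ≥ 1`, and serves as the `Δ` of Shimura's criterion
Prop. 3.8 for both `Γ₁(N)` and `Γ₀(N)`. [folklore] -/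
def delta0 : Set (GL (Fin 2) ℝ) :=
  {x | ∃ X : Matrix (Fin 2) (Fin 2) ℤ, (x : Matrix (Fin 2) (Fin 2) ℝ) = X.map (Int.castRingHom ℝ) ∧
    (N : ℤ) ∣ X 1 0 ∧ IsCoprime (X 0 0) N}

omit [NeZero N] in
/-- `Γ₀(N) ⊆ Δ₀(N)` (`gcd(a, N) = 1` from `ad - bc = 1`, `N ∣ c`). [folklore] -/
lemma gamma0_subset_delta0 :
    ((Gamma0 N : Subgroup (GL (Fin 2) ℝ)) : Set (GL (Fin 2) ℝ)) ⊆ delta0 N := by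
  rintro x ⟨γ, hγ, rfl⟩
  have h10 : ((γ 1 0 : ℤ) : ZMod N) = 0 := Gamma0_mem.mp hγ
  obtain ⟨t, ht⟩ := (ZMod.intCast_zmod_eq_zero_iff_dvd _ N).mp h10
  refine ⟨γ, rfl, ⟨t, ht⟩, ⟨γ 1 1, -(γ 0 1 * t), ?_⟩⟩
  have hdet := γ.det_coe
  rw [Matrix.det_fin_two, ht] at hdet
  linear_combination hdet

omit [NeZero N] in
/-- `Γ₁(N) ⊆ Δ₀(N)`. [folklore] -/
lemma gamma1_subset_delta0 :
    ((Gamma1 N : Subgroup (GL (Fin 2) ℝ)) : Set (GL (Fin 2) ℝ)) ⊆ delta0 N :=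
  (Set.image_mono (Gamma1_in_Gamma0 N)).trans (gamma0_subset_delta0 N)

omit [NeZero N] in
/-- `Δ₀(N)` is closed under multiplication. [folklore] -/
lemma mul_mem_delta0 {x y : GL (Fin 2) ℝ} (hx : x ∈ delta0 N) (hy : y ∈ delta0 N) :
    x * y ∈ delta0 N := by
  obtain ⟨X, hxX, hXc, hXa⟩ := hx
  obtain ⟨Y, hyY, hYc, hYa⟩ := hy
  obtain ⟨t, ht⟩ := hYc
  refine ⟨X * Y, ?_, ?_, ?_⟩
  · rw [Matrix.GeneralLinearGroup.coe_mul, hxX, hyY, Matrix.map_mul]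
  · simp only [Matrix.mul_apply, Fin.sum_univ_two]
    exact dvd_add (dvd_mul_of_dvd_left hXc _) (dvd_mul_of_dvd_right ⟨t, ht⟩ _)
  · simp only [Matrix.mul_apply, Fin.sum_univ_two]
    have : X 0 0 * Y 0 0 + X 0 1 * Y 1 0 = X 0 0 * Y 0 0 + N * (X 0 1 * t) := by rw [ht]; ring
    rw [this]
    exact (hXa.mul_left hYa).add_mul_left_left _

omit [NeZero N] in
/-- `diag(1, m) ∈ Δ₀(N)` for `m ≥ 1`. [folklore] -/
lemma diagOneR_mem_delta0 (m : ℕ) [NeZero m] : diagOneR m ∈ delta0 N := by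
  refine ⟨!![1, 0; 0, (m : ℤ)], ?_, by simp, by simpa using isCoprime_one_left⟩
  ext i j
  fin_cases i <;> fin_cases j <;> simp [diagGL]

/-- **`x* ∈ Γ₁(N) x Γ₁(N)` for `x ∈ Δ₀(N)`**, transported to `GL(2, ℝ)` from
`exists_gamma1_starMatrix_eq`. [cite: Shimura1971, Prop. 3.32(1)] -/
lemma starGL_mem_doubleCoset {x : GL (Fin 2) ℝ} (hx : x ∈ delta0 N) :
    starGL N x ∈ DoubleCoset.doubleCoset x
      ((Gamma1 N : Subgroup (GL (Fin 2) ℝ)) : Set (GL (Fin 2) ℝ))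
      (Gamma1 N : Subgroup (GL (Fin 2) ℝ)) := by
  have hN : (N : ℝ) ≠ 0 := by exact_mod_cast NeZero.ne N
  obtain ⟨X, hxX, hXc, hXa⟩ := hx
  obtain ⟨c', hc'⟩ := hXc
  have hXdet : X.det ≠ 0 := by
    intro h
    apply Matrix.GeneralLinearGroup.det_ne_zero x
    rw [show (x : Matrix (Fin 2) (Fin 2) ℝ) = X.map (Int.castRingHom ℝ) from hxX,
      ← RingHom.mapMatrix_apply, ← RingHom.map_det, h, map_zero]
  obtain ⟨γ, δ, hγ, hδ, heq⟩ := exists_gamma1_starMatrix_eq N X hXdet c' hc' hXa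
  refine DoubleCoset.mem_doubleCoset.mpr ⟨mapGL ℝ γ, ⟨γ, hγ, rfl⟩, mapGL ℝ δ, ⟨δ, hδ, rfl⟩, ?_⟩
  -- the matrix identity `x* = γ x δ` in `GL(2, ℝ)`
  refine Units.ext ?_
  rw [Matrix.GeneralLinearGroup.coe_mul, Matrix.GeneralLinearGroup.coe_mul, val_starGL,
    mapGL_coe_matrix, mapGL_coe_matrix, algebraMap_int_eq, map_apply_coe, map_apply_coe,
    RingHom.mapMatrix_apply, RingHom.mapMatrix_apply, hxX, ← Matrix.map_mul, ← Matrix.map_mul,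
    ← heq]
  ext i j
  fin_cases i <;> fin_cases j <;> simp [hc', hN]

/-- `x* ∈ Γ₀(N) x Γ₀(N)` for `x ∈ Δ₀(N)` (from the `Γ₁(N)` statement, `Γ₁(N) ≤ Γ₀(N)`).
[cite: Shimura1971, Prop. 3.32(1)] -/
lemma starGL_mem_doubleCoset_gamma0 {x : GL (Fin 2) ℝ} (hx : x ∈ delta0 N) :
    starGL N x ∈ DoubleCoset.doubleCoset x
      ((Gamma0 N : Subgroup (GL (Fin 2) ℝ)) : Set (GL (Fin 2) ℝ))
      (Gamma0 N : Subgroup (GL (Fin 2) ℝ)) := by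
  obtain ⟨u, hu, v, hv, huv⟩ := DoubleCoset.mem_doubleCoset.mp (starGL_mem_doubleCoset N hx)
  exact DoubleCoset.mem_doubleCoset.mpr
    ⟨u, Set.image_mono (Gamma1_in_Gamma0 N) hu, v, Set.image_mono (Gamma1_in_Gamma0 N) hv, huv⟩

end Assembly

end HeckeTComm

section Discharge

open CongruenceSubgroup

/-- **The double cosets `Γ₁(N) diag(1,m) Γ₁(N)`, `m ≥ 1`, commute pairwise in the Hecke ring**
(equality of the multisets of right cosets `{Γ₁ αᵢ βⱼ}` and `{Γ₁ βⱼ αᵢ}`). This is the instance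
`(Γ' diag(1,m) Γ')(Γ' diag(1,n) Γ') = (Γ' diag(1,n) Γ')(Γ' diag(1,m) Γ')` (`Γ' = Γ₁(N)`, i.e.
(3.3.2) with `𝔥 = {1}`, `t = 1`; `diag(1,m) ∈ Δ'` of (3.3.3)) of the commutativity of `R(Γ', Δ')`
contained in Shimura 1971, Thm. 3.34(1) (`R(Γ', Δ')` is a polynomial ring); it is proved here
directly by Shimura's criterion Prop. 3.8 for the anti-involution `x ↦ diag(1,N) xᵀ diag(1,N)⁻¹`,
which preserves `Γ₁(N)` (`HeckeTComm.star_mem_gamma1`) and satisfies `x* ∈ Γ₁(N) x Γ₁(N)` on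
`Δ₀(N)` (`HeckeTComm.starGL_mem_doubleCoset`). [cite: Shimura1971, Thm. 3.34(1) and Prop. 3.8] -/
theorem gamma1_doubleCosetsCommute_diag (N : ℕ) [NeZero N] (m n : ℕ) [NeZero m] [NeZero n] :
    DoubleCosetsCommute (Gamma1 N : Subgroup (GL (Fin 2) ℝ)) (diagOneR m) (diagOneR n) :=
  doubleCosetsCommute_of_antiInvolution (HeckeTComm.starGL N)
    (HeckeTComm.star_mul_eq N _ (HeckeTComm.val_starGL N))
    (HeckeTComm.star_involutive N _ (HeckeTComm.val_starGL N))
    (fun _ hγ ↦ HeckeTComm.star_mem_gamma1 N _ (HeckeTComm.val_starGL N) hγ)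
    (HeckeTComm.gamma1_subset_delta0 N) (fun _ hx _ hy ↦ HeckeTComm.mul_mem_delta0 N hx hy)
    (fun _ hx ↦ HeckeTComm.starGL_mem_doubleCoset N hx)
    (HeckeTComm.diagOneR_mem_delta0 N m) (HeckeTComm.diagOneR_mem_delta0 N n)

/-- **The double cosets `Γ₀(N) diag(1,m) Γ₀(N)`, `m ≥ 1`, commute pairwise in the Hecke ring**
(the case `𝔥 = (ℤ/Nℤ)ˣ`, `t = 1` of (3.3.2), i.e. `Γ' = Γ₀(N)`, of the commutativity of `R(Γ', Δ')`,
Shimura 1971, Thm. 3.34(1)), by the same anti-involution argument (Prop. 3.8).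
[cite: Shimura1971, Thm. 3.34(1) and Prop. 3.8] -/
theorem gamma0_doubleCosetsCommute_diag (N : ℕ) [NeZero N] (m n : ℕ) [NeZero m] [NeZero n] :
    DoubleCosetsCommute (Gamma0 N : Subgroup (GL (Fin 2) ℝ)) (diagOneR m) (diagOneR n) :=
  doubleCosetsCommute_of_antiInvolution (HeckeTComm.starGL N)
    (HeckeTComm.star_mul_eq N _ (HeckeTComm.val_starGL N))
    (HeckeTComm.star_involutive N _ (HeckeTComm.val_starGL N))
    (fun _ hγ ↦ HeckeTComm.star_mem_gamma0 N _ (HeckeTComm.val_starGL N) hγ)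
    (HeckeTComm.gamma0_subset_delta0 N) (fun _ hx _ hy ↦ HeckeTComm.mul_mem_delta0 N hx hy)
    (fun _ hx ↦ HeckeTComm.starGL_mem_doubleCoset_gamma0 N hx)
    (HeckeTComm.diagOneR_mem_delta0 N m) (HeckeTComm.diagOneR_mem_delta0 N n)

/-- **Discharge of the named fact `heckeT_comm`**: for every `N ≥ 1`, every weight `k` and all
`p, q ≥ 1`, the operators `T_p = [Γ₁(N) diag(1,p) Γ₁(N)]` and `T_q` on `S_k(Γ₁(N))` commute.
For `p, q` prime this is Diamond–Shurman Prop. 5.2.4(c) (there proved from the Fourier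
coefficient formula (5.4)); the general statement is the commutativity of the double cosets
(`gamma1_doubleCosetsCommute_diag`, Shimura 1971, Thm. 3.34(1) via Prop. 3.8) transported by the
double coset formula (3.4.1) and Prop. 3.38. [cite: DiamondShurman2005, Prop. 5.2.4(c)] -/
theorem heckeT_comm_holds (N : ℕ) [NeZero N] (k : ℤ) : heckeT_comm N k :=
  heckeT_comm_of_doubleCosetsCommute N k fun p q _ _ ↦ gamma1_doubleCosetsCommute_diag N p q

/-- **Discharge of the named fact `heckeT_comm_gamma0`**: for every `N ≥ 1`, every weight `k` and
all `p, q ≥ 1`, the operators `T_p = [Γ₀(N) diag(1,p) Γ₀(N)]` and `T_q` on `S_k(Γ₀(N))` commute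
(Diamond–Shurman Prop. 5.2.4(c) with §5.2, `S_k(Γ₀(N)) = S_k(N, 𝟙)`, for `p, q` prime; in general
by `gamma0_doubleCosetsCommute_diag`). [cite: DiamondShurman2005, Prop. 5.2.4(c)] -/
theorem heckeT_comm_gamma0_holds (N : ℕ) [NeZero N] (k : ℤ) : heckeT_comm_gamma0 N k :=
  fun p q _ _ ↦ heckeT_comm_of_doubleCosetsCommute' _ k p q (gamma0_doubleCosetsCommute_diag N p q)

/-- `T_p T_q = T_q T_p` on the full space of modular forms `M_k(Γ₁(N))`, all `p, q ≥ 1`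
(`modHeckeT`; for `p, q` prime this is Diamond–Shurman Prop. 5.2.4(c) exactly as printed, on
`M_k(Γ₁(N))`). [cite: DiamondShurman2005, Prop. 5.2.4(c)] -/
theorem modHeckeT_comm_gamma1 (N : ℕ) [NeZero N] (k : ℤ) (p q : ℕ) [NeZero p] [NeZero q] :
    modHeckeT (Gamma1 N) k p * modHeckeT (Gamma1 N) k q =
      modHeckeT (Gamma1 N) k q * modHeckeT (Gamma1 N) k p :=
  modHeckeT_comm_of_doubleCosetsCommute' _ k p q (gamma1_doubleCosetsCommute_diag N p q)

end Discharge

end Literature.NumberTheory.EllipticCurves.ModularForms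

end
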